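import Literature.Probability.FitznerVanDerHofstad2017.SrwTrigMajorantKM2
import Literature.Probability.FitznerVanDerHofstad2017.SrwIntegralTU
import Literature.Probability.FitznerVanDerHofstad2017.SrwTwistInsertedRow
import Literature.Probability.FitznerVanDerHofstad2017.SrwTwistProductWeight
import Literature.Probability.FitznerVanDerHofstad2017.SrwTwistTruncationSeeds
import Mathlib.Algebra.BigOperators.Fin
import HarnessLib

/-!
# Cosine-power inserted rows and the multinomial reduction of `D̂^l`-weighted twisted seeds

The WEIGHTED slices of a twisted-seed kernel (Fitzner–van der Hofstad, *NoBLE* §5.1.1) need the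
twisted moments `srwTwist d (n+1) w (m e_i) β` for the weights `w = D̂^l` (and products with the
coordinate cosines).  Since `D̂(k) = d⁻¹ Σ_μ cos k_μ`, the multinomial expansion writes
`D̂(k)^l = d^{-l} Σ_{p : Fin l → Fin d} Π_μ (cos k_μ)^{a_μ(p)}`, `a_μ(p) = #{t : p t = μ}`,
so — by linearity of `srwTwist` in the weight and the product-weight Schwinger–Fubini form
(`SrwTwistProductWeight`) — each such moment is a finite average of `u`-integrals of PRODUCTS over
the coordinates of one-dimensional rows with a cosine power inserted,
`T^{(a)}_m(v, y) = ∫_{[-π,π]} (cos t)^a e^{v cos t + i y cos(m t)} dt`.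

Writing `(cos t)^a = 2^{-a} Σ_{s=0}^{a} C(a,s) e^{i(2s-a)t}` makes `T^{(a)}` an inserted row in the
sense of `SrwTwistInsertedRow`: its Fourier–Bessel expansion in the twist has the SAME coefficients
`F_j = 2π i^{|j|} J_{|j|}(y)` and the shifted plain weights
`W^{(a)}_j(v) = 2^{-a} Σ_s C(a,s) I_{jm-(2s-a)}(v)` (coefficient 1-norm exactly `1`).  This file records:

* `hasSum_insertedFamily_μI` — the inserted-row expansion for a family of characters indexed by any
  finite set (frequencies may repeat), with its weight bound `norm_insertedFamilyWeight_le` and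
  two-sided order ball `norm_insertedFamily_add_sub_sum_range_le`;
* `ofReal_cos_pow_eq_sum_cexp`, `hasSum_cos_pow_besselRow_μI`, the unit anchor
  `norm_cosPowRow_μI_le : ‖T^{(a)}_m(v,y)‖ ≤ 2π I_0(v)` and the order ball
  `norm_cosPowRow_add_sub_sum_range_le` (cost `4π I_{(J+1)|m|-a}(v) Σ_{l>J} |J_l(y)|`); the weights
  are even in the twist index (`cosPowWeight_neg`), so the row folds onto `ℕ` in the kernel's format
  (`hasSum_nat_eps_of_hasSum_int_even`, `hasSum_cos_pow_besselRow_nat_μI`);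
* `Dhat_pow_eq_sum_prod_cos_pow` (the multinomial reduction), its twisted-moment form
  `srwTwist_Dhat_pow_eq_sum_srwTwist_prodCosPow` (`Tw^{D̂^l}_n = d^{-l}Σ_p Tw^{Π cos^{a(p)}}_n`, also for
  `|D̂|^l`, `l` even) and the assembled `u`-representation
  `srwTwist_succ_Dhat_pow_single_eq` of the `D̂^l`-weighted twisted moment at an axis node
  (`|D̂|^l = D̂^l` for even `l`: `srwTwist_succ_abs_Dhat_pow_single_eq_of_even`); and the `U`-type
  weight `D̂^l D̂^{sin}`: `Dhat_pow_mul_Dsin_eq_sum`, `srwTwist_succ_Dhat_pow_mul_Dsin_single_eq`, whose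
extra factor row is `integral_cos_pow_mul_sin_sq_row_eq_sub` (`cos^a sin² ↦ T^{(a)} − T^{(a+2)}`), and
  `D̂^l (D̂^{sin})²`: `Dhat_pow_mul_Dsin_sq_eq_sum`, `srwTwist_succ_Dhat_pow_mul_Dsin_sq_single_eq`
  (factor row `integral_cos_pow_mul_sin_sq_mul_sin_sq_row_eq`: `cos^a sin⁴ ↦ T^{(a)} − 2T^{(a+2)} + T^{(a+4)}`);
  `norm_weightRow_μI_le` is the unit anchor for any insertion `|g| ≤ 1`;
* `srwTwist_weight_mul_Mhat_sq_eq` — the `M̂²` insertion (`KM₂` weights `|D̂|^l M̂²`) as a signed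
  combination of `D̂`-polynomial × `D̂^{sin}`-power weights at Schwinger orders `n, n+1, n+2`
  (`M̂ = D̂ − 2D̂^{sin}Ĉ`; `srwTwist_weight_mul_Chat_pow_eq`, `srwTwist_add_weight`, `srwTwist_const_mul_weight`);
* `norm_cosPowRow_sub_foldTrunc_le` (the order ball for the FOLDED row `Σ_{j≤J} ε_j W^{(a)}_j F_j`) and
  `abs_srwTwist_prodCosPow_sub_rowTrunc_le_sum_srwI` — truncating every coordinate row of a product
  cos-power twisted seed at order `J` costs `Σ_{k<d} C(d,k+1)(2δ_J)^{k+1} srwI d (n+1) 0 (c(e_0+…+e_k))`,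
  `c = (J+1)M − a_max` (`M ≤ |m|`, `a_μ ≤ a_max ≤ (J+1)M`), `δ_J = Σ_{l≥0}|J_{l+J+1}(β/d)|` — the
  product analogue of `abs_srwTwist_sub_rowTrunc_le_sum_srwI_unit` (`SrwTwistTruncationSeeds`), so the
  tails of the weighted slices are again PLAIN seeds `srwI`; one-seed coarsening
  `abs_srwTwist_prodCosPow_sub_rowTrunc_le_incr_mul_srwI` (`((1+2δ_J)^d − 1)·srwI d (n+1) 0 (c e_0)`).

Everything is PROVED (standard axioms), `d`-generic and number-free; no definition, no named fact.
Epistemic status / lane: what-if / input-certification SUPPORT (glue between the weighted consumer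
interface `|D̂|^l`, `|D̂|^l D̂^{sin}`, `|D̂|^l M̂²` and the one-coordinate inserted-row kernel inputs);
nothing here is a certificate; no statement at a specific dimension.

## References
* R. Fitzner, R. van der Hofstad, PTRF 169 (2017) 1041–1119, §3.3.3 p. 1070, (3.34)–(3.38) p. 1071,
  §5.1.1 (5.2)–(5.5), §5.2 (5.9), (5.14) p. 1092. [FitznerVanDerHofstad2016NoBLE]
* NIST DLMF §10.35.2 (generating function / Jacobi–Anger), §10.32.1 (`I_0` integral), §10.14.4. [DLMF]
* G. N. Watson, *A Treatise on the Theory of Bessel Functions* (1944), §2.22, §3.71. [Watson1944]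
-/

open MeasureTheory Set Filter Real
open scoped Topology Nat

namespace Literature.Probability.FitznerVanDerHofstad2017

open Literature.Barriers.CriticalPhenomena
open Literature.Barriers.CriticalPhenomena.Slade2006Prop53 (μI P)
open Literature.Probability.LatticeModels (besselI besselI_nonneg besselI_le_of_natAbs_le srwHeatKernel
  continuous_srwHeatKernel_left)
open Literature.Analysis.FunctionSpaces (besselJ)

/-- `|e^{iat}| = 1`. [folklore] -/
private theorem norm_cexp_intCast_mul'' (a : ℤ) (t : ℝ) :
    ‖Complex.exp ((a : ℂ) * t * Complex.I)‖ = 1 := by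
  rw [show (a : ℂ) * t * Complex.I = ((a * t : ℝ) : ℂ) * Complex.I by push_cast; ring,
    Complex.norm_exp_ofReal_mul_I]

/-! ### Inserted families of characters -/

/-- **Inserted family**: for a finite family of characters `Σ_{s∈S} ω_s e^{i r_s t}` (frequencies may
repeat), `∫_{[-π,π]} (Σ_s ω_s e^{i r_s t}) e^{v cos t + iy cos(mt)} dt = Σ_{j∈ℤ} W_j F_j` with
`W_j = Σ_s ω_s I_{jm - r_s}(v)` and `F_j = 2π i^{|j|} J_{|j|}(y)` (`m ≠ 0`): inserting a character only
shifts the index of the plain Bessel weight.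
[cite: DLMF, 10.35.2; FitznerVanDerHofstad2016NoBLE, §5.1.1 (5.2)–(5.4)] -/
theorem hasSum_insertedFamily_μI {ι : Type*} (S : Finset ι) (r : ι → ℤ) (ω : ι → ℂ)
    (v y : ℝ) {m : ℤ} (hm : m ≠ 0) :
    HasSum (fun j : ℤ => (∑ s ∈ S, ω s * (besselI (j * m - r s) v : ℂ))
        * (2 * π * Complex.I ^ j.natAbs * (besselJ j.natAbs y : ℂ)))
      (∫ t, (∑ s ∈ S, ω s * Complex.exp ((r s : ℂ) * t * Complex.I))
        * Complex.exp (((v * Real.cos t : ℝ) : ℂ) + ((y * Real.cos (m * t) : ℝ) : ℂ) * Complex.I) ∂μI) := by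
  have hint : ∀ a : ℤ, Integrable (fun t : ℝ => Complex.exp ((a : ℂ) * t * Complex.I)
      * Complex.exp (((v * Real.cos t : ℝ) : ℂ) + ((y * Real.cos (m * t) : ℝ) : ℂ) * Complex.I)) μI := by
    intro a
    have hc : Continuous (fun t : ℝ => Complex.exp ((a : ℂ) * t * Complex.I)
        * Complex.exp (((v * Real.cos t : ℝ) : ℂ) + ((y * Real.cos (m * t) : ℝ) : ℂ) * Complex.I)) := by
      fun_prop
    exact hc.continuousOn.integrableOn_compact isCompact_Icc
  have h1 := hasSum_sum (s := S) (f := fun (s : ι) (j : ℤ) => ω s * ((besselI (j * m - r s) v : ℂ)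
      * (2 * π * Complex.I ^ j.natAbs * (besselJ j.natAbs y : ℂ))))
    (fun s _ => (hasSum_insertedChar_besselRow_μI v y hm (r s)).mul_left (ω s))
  have hval : (∑ s ∈ S, ω s * ∫ t, Complex.exp ((r s : ℂ) * t * Complex.I)
        * Complex.exp (((v * Real.cos t : ℝ) : ℂ) + ((y * Real.cos (m * t) : ℝ) : ℂ) * Complex.I) ∂μI)
      = ∫ t, (∑ s ∈ S, ω s * Complex.exp ((r s : ℂ) * t * Complex.I))
        * Complex.exp (((v * Real.cos t : ℝ) : ℂ) + ((y * Real.cos (m * t) : ℝ) : ℂ) * Complex.I) ∂μI := by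
    simp_rw [← integral_const_mul]
    rw [← integral_finsetSum S (fun s _ => (hint (r s)).const_mul (ω s))]
    refine integral_congr_ae (ae_of_all _ fun t => ?_)
    simp only [Finset.sum_mul, mul_assoc]
  rw [hval] at h1
  refine h1.congr_fun fun j => ?_
  rw [Finset.sum_mul]
  refine Finset.sum_congr rfl fun s _ => ?_
  ring

/-- An inserted family is bounded by the coefficient 1-norm times the untwisted transform:
`‖∫ (Σ_s ω_s e^{i r_s t}) e^{v cos t + iy cos(mt)} dt‖ ≤ (Σ_s ‖ω_s‖) · 2π I_0(v)`.
[cite: DLMF, 10.32.1; FitznerVanDerHofstad2016NoBLE, §5.1.1 (5.2)–(5.4)] -/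
theorem norm_insertedFamily_μI_le {ι : Type*} (S : Finset ι) (r : ι → ℤ) (ω : ι → ℂ)
    (v y : ℝ) (m : ℤ) :
    ‖∫ t, (∑ s ∈ S, ω s * Complex.exp ((r s : ℂ) * t * Complex.I))
        * Complex.exp (((v * Real.cos t : ℝ) : ℂ) + ((y * Real.cos (m * t) : ℝ) : ℂ) * Complex.I) ∂μI‖
      ≤ (∑ s ∈ S, ‖ω s‖) * (2 * π * besselI 0 v) := by
  have hE : ∀ t : ℝ, ‖Complex.exp (((v * Real.cos t : ℝ) : ℂ)
      + ((y * Real.cos (m * t) : ℝ) : ℂ) * Complex.I)‖ = Real.exp (v * Real.cos t) := by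
    intro t
    rw [Complex.norm_exp, Complex.add_re, Complex.ofReal_re, Complex.mul_I_re, Complex.ofReal_im,
      neg_zero, add_zero]
  have hω : ∀ t : ℝ, ‖∑ s ∈ S, ω s * Complex.exp ((r s : ℂ) * t * Complex.I)‖ ≤ ∑ s ∈ S, ‖ω s‖ := by
    intro t
    refine (norm_sum_le _ _).trans (Finset.sum_le_sum fun s _ => ?_)
    rw [norm_mul, norm_cexp_intCast_mul'', mul_one]
  have hptw : ∀ t : ℝ, ‖(∑ s ∈ S, ω s * Complex.exp ((r s : ℂ) * t * Complex.I))
      * Complex.exp (((v * Real.cos t : ℝ) : ℂ) + ((y * Real.cos (m * t) : ℝ) : ℂ) * Complex.I)‖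
      ≤ (∑ s ∈ S, ‖ω s‖) * Real.exp (v * Real.cos t) := by
    intro t
    rw [norm_mul, hE]
    exact mul_le_mul_of_nonneg_right (hω t) (Real.exp_pos _).le
  have hint : Integrable (fun t : ℝ => (∑ s ∈ S, ‖ω s‖) * Real.exp (v * Real.cos t)) μI := by
    have hc : Continuous (fun t : ℝ => (∑ s ∈ S, ‖ω s‖) * Real.exp (v * Real.cos t)) := by fun_prop
    exact hc.continuousOn.integrableOn_compact isCompact_Icc
  calc ‖∫ t, (∑ s ∈ S, ω s * Complex.exp ((r s : ℂ) * t * Complex.I))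
        * Complex.exp (((v * Real.cos t : ℝ) : ℂ) + ((y * Real.cos (m * t) : ℝ) : ℂ) * Complex.I) ∂μI‖
      ≤ ∫ t, (∑ s ∈ S, ‖ω s‖) * Real.exp (v * Real.cos t) ∂μI :=
        norm_integral_le_of_norm_le hint (ae_of_all _ hptw)
    _ = (∑ s ∈ S, ‖ω s‖) * (2 * π * besselI 0 v) := by
        rw [integral_const_mul, integral_exp_mul_cos_μI]

/-- The shifted weight of an inserted family off the truncation window: for `v ≥ 0`, `|r_s| ≤ ρ` on `S`,
`ρ ≤ (J+1)|m|` and `|j| ≥ J+1`, `‖Σ_s ω_s I_{jm - r_s}(v)‖ ≤ (Σ_s ‖ω_s‖) I_{(J+1)|m| - ρ}(v)`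
(`I_a(v)` is non-increasing in `|a|` and `|jm - r_s| ≥ (J+1)|m| - ρ`). [cite: Watson1944, §3.71] -/
theorem norm_insertedFamilyWeight_le {ι : Type*} (S : Finset ι) (r : ι → ℤ) (ω : ι → ℂ)
    {v : ℝ} (hv : 0 ≤ v) (m : ℤ) {J ρ : ℕ} (hρ : ∀ s ∈ S, (r s).natAbs ≤ ρ)
    (hJ : ρ ≤ (J + 1) * m.natAbs) {j : ℤ} (hj : J + 1 ≤ j.natAbs) :
    ‖∑ s ∈ S, ω s * (besselI (j * m - r s) v : ℂ)‖
      ≤ (∑ s ∈ S, ‖ω s‖) * besselI ((((J + 1) * m.natAbs - ρ : ℕ)) : ℤ) v := by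
  rw [Finset.sum_mul]
  refine (norm_sum_le _ _).trans (Finset.sum_le_sum fun s hs => ?_)
  rw [norm_mul, Complex.norm_real, Real.norm_eq_abs, abs_of_nonneg (besselI_nonneg hv _)]
  refine mul_le_mul_of_nonneg_left (besselI_le_of_natAbs_le hv ?_) (norm_nonneg _)
  have h1 : (j * m).natAbs ≤ (j * m - r s).natAbs + (r s).natAbs := by
    have := Int.natAbs_add_le (j * m - r s) (r s)
    rwa [sub_add_cancel] at this
  have h2 : (J + 1) * m.natAbs ≤ (j * m).natAbs := by
    rw [Int.natAbs_mul]; exact Nat.mul_le_mul_right _ hj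
  have h3 := hρ s hs
  simp only [Int.natAbs_natCast]
  omega

/-- **Two-sided order ball for an inserted family.** With `W_j = Σ_s ω_s I_{jm - r_s}(v)`,
`F_j = 2π i^{|j|} J_{|j|}(y)`, `v ≥ 0`, `m ≠ 0` and `|r_s| ≤ ρ ≤ (J+1)|m|` on `S`:
`‖∫ (Σ_s ω_s e^{i r_s t}) e^{v cos t + iy cos(mt)} dt + W_0 F_0 − Σ_{n ≤ J} (W_n F_n + W_{-n} F_{-n})‖`
`≤ 4π (Σ_s ‖ω_s‖) I_{(J+1)|m|-ρ}(v) Σ_{l ≥ J+1} |J_l(y)|`.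
[cite: DLMF, 10.35.2; DLMF, 10.14.4; Watson1944, §3.71; FitznerVanDerHofstad2016NoBLE, §5.1.1 (5.2)–(5.4)] -/
theorem norm_insertedFamily_add_sub_sum_range_le {ι : Type*} (S : Finset ι) (r : ι → ℤ) (ω : ι → ℂ)
    {v : ℝ} (hv : 0 ≤ v) (y : ℝ) {m : ℤ} (hm : m ≠ 0) {J ρ : ℕ}
    (hρ : ∀ s ∈ S, (r s).natAbs ≤ ρ) (hJ : ρ ≤ (J + 1) * m.natAbs) :
    ‖(∫ t, (∑ s ∈ S, ω s * Complex.exp ((r s : ℂ) * t * Complex.I))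
        * Complex.exp (((v * Real.cos t : ℝ) : ℂ) + ((y * Real.cos (m * t) : ℝ) : ℂ) * Complex.I) ∂μI)
      + (∑ s ∈ S, ω s * (besselI (0 * m - r s) v : ℂ))
          * (2 * π * Complex.I ^ (0 : ℤ).natAbs * (besselJ (0 : ℤ).natAbs y : ℂ))
      - ∑ n ∈ Finset.range (J + 1),
          ((∑ s ∈ S, ω s * (besselI (n * m - r s) v : ℂ))
              * (2 * π * Complex.I ^ (n : ℤ).natAbs * (besselJ (n : ℤ).natAbs y : ℂ))
            + (∑ s ∈ S, ω s * (besselI (-(n : ℤ) * m - r s) v : ℂ))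
              * (2 * π * Complex.I ^ (-(n : ℤ)).natAbs * (besselJ (-(n : ℤ)).natAbs y : ℂ)))‖
      ≤ 4 * π * (∑ s ∈ S, ‖ω s‖) * besselI ((((J + 1) * m.natAbs - ρ : ℕ)) : ℤ) v
          * ∑' l : ℕ, |besselJ (l + J + 1) y| := by
  have h := norm_add_sub_sum_range_le_of_hasSum_int y (hasSum_insertedFamily_μI S r ω v y hm) J
    (C := 2 * π * ((∑ s ∈ S, ‖ω s‖) * besselI ((((J + 1) * m.natAbs - ρ : ℕ)) : ℤ) v)) ?_
  · beta_reduce at h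
    refine h.trans_eq ?_
    ring
  · intro j hj
    rw [norm_mul, show ‖(2 * π * Complex.I ^ j.natAbs * (besselJ j.natAbs y : ℂ))‖
        = 2 * π * |besselJ j.natAbs y| by
      rw [norm_mul, norm_mul, norm_pow, Complex.norm_I, one_pow, mul_one, Complex.norm_real,
        Real.norm_eq_abs, norm_mul, Complex.norm_real, Real.norm_eq_abs, abs_of_pos Real.pi_pos,
        Complex.norm_ofNat]]
    have hW := norm_insertedFamilyWeight_le S r ω hv m hρ hJ hj
    have hJn : 0 ≤ |besselJ j.natAbs y| := abs_nonneg _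
    calc ‖∑ s ∈ S, ω s * (besselI (j * m - r s) v : ℂ)‖ * (2 * π * |besselJ j.natAbs y|)
        ≤ ((∑ s ∈ S, ‖ω s‖) * besselI ((((J + 1) * m.natAbs - ρ : ℕ)) : ℤ) v)
            * (2 * π * |besselJ j.natAbs y|) :=
          mul_le_mul_of_nonneg_right hW (by positivity)
      _ = 2 * π * ((∑ s ∈ S, ‖ω s‖) * besselI ((((J + 1) * m.natAbs - ρ : ℕ)) : ℤ) v)
            * |besselJ j.natAbs y| := by ring

/-! ### Cosine powers as families of characters -/

/-- `(cos t)^a = 2^{-a} Σ_{s=0}^{a} C(a,s) e^{i(2s-a)t}` (binomial expansion of `(½(e^{it}+e^{-it}))^a`).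
[cite: DLMF, 10.35.2; Watson1944, §2.22] -/
theorem ofReal_cos_pow_eq_sum_cexp (a : ℕ) (t : ℝ) :
    (((Real.cos t) ^ a : ℝ) : ℂ) = ∑ s ∈ Finset.range (a + 1),
      ((a.choose s : ℂ) / 2 ^ a) * Complex.exp ((((2 * (s : ℤ) - a : ℤ)) : ℂ) * t * Complex.I) := by
  rw [Complex.ofReal_pow, Complex.ofReal_cos, Complex.cos, div_pow, add_pow, Finset.sum_div]
  refine Finset.sum_congr rfl fun s hs => ?_
  have hs' : s ≤ a := Nat.lt_succ_iff.mp (Finset.mem_range.mp hs)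
  rw [← Complex.exp_nat_mul, ← Complex.exp_nat_mul, ← Complex.exp_add, Nat.cast_sub hs']
  have he : (s : ℂ) * ((t : ℂ) * Complex.I) + ((a : ℂ) - s) * (-(t : ℂ) * Complex.I)
      = (((2 * (s : ℤ) - a : ℤ)) : ℂ) * t * Complex.I := by
    push_cast; ring
  rw [he]
  ring

/-- **`cos^a`-inserted row**: `T^{(a)}_m(v,y) = ∫_{[-π,π]} (cos t)^a e^{v cos t + iy cos(mt)} dt`
`= Σ_{j∈ℤ} W^{(a)}_j(v) F_j` with `W^{(a)}_j(v) = 2^{-a} Σ_{s=0}^{a} C(a,s) I_{jm-(2s-a)}(v)` and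
`F_j = 2π i^{|j|} J_{|j|}(y)` (`m ≠ 0`). Cases: `a = 1` gives `½(I_{jm-1}+I_{jm+1})`, `a = 2` gives
`¼(I_{jm-2} + 2 I_{jm} + I_{jm+2})`. [cite: DLMF, 10.35.2; FitznerVanDerHofstad2016NoBLE, §5.1.1 (5.2)–(5.4)] -/
theorem hasSum_cos_pow_besselRow_μI (a : ℕ) (v y : ℝ) {m : ℤ} (hm : m ≠ 0) :
    HasSum (fun j : ℤ => (∑ s ∈ Finset.range (a + 1),
          ((a.choose s : ℂ) / 2 ^ a) * (besselI (j * m - ((2 * (s : ℤ) - a : ℤ))) v : ℂ))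
        * (2 * π * Complex.I ^ j.natAbs * (besselJ j.natAbs y : ℂ)))
      (∫ t, (((Real.cos t) ^ a : ℝ) : ℂ)
        * Complex.exp (((v * Real.cos t : ℝ) : ℂ) + ((y * Real.cos (m * t) : ℝ) : ℂ) * Complex.I) ∂μI) := by
  have h := hasSum_insertedFamily_μI (Finset.range (a + 1)) (fun s : ℕ => (2 * (s : ℤ) - a : ℤ))
    (fun s : ℕ => ((a.choose s : ℂ) / 2 ^ a)) v y hm
  have hfun : (fun t : ℝ => (∑ s ∈ Finset.range (a + 1), ((a.choose s : ℂ) / 2 ^ a)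
        * Complex.exp ((((2 * (s : ℤ) - a : ℤ)) : ℂ) * t * Complex.I))
        * Complex.exp (((v * Real.cos t : ℝ) : ℂ) + ((y * Real.cos (m * t) : ℝ) : ℂ) * Complex.I))
      = fun t : ℝ => (((Real.cos t) ^ a : ℝ) : ℂ)
        * Complex.exp (((v * Real.cos t : ℝ) : ℂ) + ((y * Real.cos (m * t) : ℝ) : ℂ) * Complex.I) := by
    funext t; rw [ofReal_cos_pow_eq_sum_cexp]
  rw [hfun] at h
  exact h

/-- **Unit anchor for a bounded real insertion**: if `|g| ≤ 1` then
`‖∫_{[-π,π]} g(t) e^{v cos t + iy cos(mt)} dt‖ ≤ 2π I_0(v)` (`|e^{iy cos(mt)}| = 1`, `∫ e^{v cos t} dt = 2π I_0(v)`).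
[cite: DLMF, 10.32.1; FitznerVanDerHofstad2016NoBLE, §5.1.1 (5.2)–(5.4)] -/
theorem norm_weightRow_μI_le (g : ℝ → ℝ) (hg1 : ∀ t, |g t| ≤ 1) (v y : ℝ) (m : ℤ) :
    ‖∫ t, (g t : ℂ)
        * Complex.exp (((v * Real.cos t : ℝ) : ℂ) + ((y * Real.cos (m * t) : ℝ) : ℂ) * Complex.I) ∂μI‖
      ≤ 2 * π * besselI 0 v := by
  have hE : ∀ t : ℝ, ‖Complex.exp (((v * Real.cos t : ℝ) : ℂ)
      + ((y * Real.cos (m * t) : ℝ) : ℂ) * Complex.I)‖ = Real.exp (v * Real.cos t) := by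
    intro t
    rw [Complex.norm_exp, Complex.add_re, Complex.ofReal_re, Complex.mul_I_re, Complex.ofReal_im,
      neg_zero, add_zero]
  have hptw : ∀ t : ℝ, ‖(g t : ℂ)
      * Complex.exp (((v * Real.cos t : ℝ) : ℂ) + ((y * Real.cos (m * t) : ℝ) : ℂ) * Complex.I)‖
      ≤ Real.exp (v * Real.cos t) := by
    intro t
    rw [norm_mul, hE, Complex.norm_real, Real.norm_eq_abs]
    exact mul_le_of_le_one_left (Real.exp_pos _).le (hg1 t)
  have hint : Integrable (fun t : ℝ => Real.exp (v * Real.cos t)) μI := by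
    have hc : Continuous (fun t : ℝ => Real.exp (v * Real.cos t)) := by fun_prop
    exact hc.continuousOn.integrableOn_compact isCompact_Icc
  calc ‖∫ t, (g t : ℂ)
        * Complex.exp (((v * Real.cos t : ℝ) : ℂ) + ((y * Real.cos (m * t) : ℝ) : ℂ) * Complex.I) ∂μI‖
      ≤ ∫ t, Real.exp (v * Real.cos t) ∂μI := norm_integral_le_of_norm_le hint (ae_of_all _ hptw)
    _ = 2 * π * besselI 0 v := integral_exp_mul_cos_μI v

/-- **Unit anchor** `‖T^{(a)}_m(v,y)‖ ≤ 2π I_0(v)` (`|cos^a t| ≤ 1`).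
[cite: DLMF, 10.32.1; FitznerVanDerHofstad2016NoBLE, §5.1.1 (5.2)–(5.4)] -/
theorem norm_cosPowRow_μI_le (a : ℕ) (v y : ℝ) (m : ℤ) :
    ‖∫ t, (((Real.cos t) ^ a : ℝ) : ℂ)
        * Complex.exp (((v * Real.cos t : ℝ) : ℂ) + ((y * Real.cos (m * t) : ℝ) : ℂ) * Complex.I) ∂μI‖
      ≤ 2 * π * besselI 0 v :=
  norm_weightRow_μI_le (fun t => (Real.cos t) ^ a)
    (fun t => by rw [abs_pow]; exact pow_le_one₀ (abs_nonneg _) (abs_cos_le_one t)) v y m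

/-- **`cos^a sin²`-inserted row = difference of two cosine-power rows**:
`∫ (cos t)^a sin²t · e^{v cos t + iy cos(mt)} dt = T^{(a)}_m(v,y) − T^{(a+2)}_m(v,y)` (`sin² = 1 − cos²`) —
the factor produced by one `D̂^{sin}` insertion at a coordinate.
[cite: FitznerVanDerHofstad2016NoBLE, §3.3.3 p. 1070, §5.1.1 (5.2)–(5.4); DLMF, 10.35.2] -/
theorem integral_cos_pow_mul_sin_sq_row_eq_sub (a : ℕ) (v y : ℝ) (m : ℤ) :
    ∫ t, (((Real.cos t) ^ a * (Real.sin t) ^ 2 : ℝ) : ℂ)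
        * Complex.exp (((v * Real.cos t : ℝ) : ℂ) + ((y * Real.cos (m * t) : ℝ) : ℂ) * Complex.I) ∂μI
      = (∫ t, (((Real.cos t) ^ a : ℝ) : ℂ)
          * Complex.exp (((v * Real.cos t : ℝ) : ℂ) + ((y * Real.cos (m * t) : ℝ) : ℂ) * Complex.I) ∂μI)
        - ∫ t, (((Real.cos t) ^ (a + 2) : ℝ) : ℂ)
          * Complex.exp (((v * Real.cos t : ℝ) : ℂ) + ((y * Real.cos (m * t) : ℝ) : ℂ) * Complex.I) ∂μI := by
  have hint : ∀ b : ℕ, Integrable (fun t : ℝ => (((Real.cos t) ^ b : ℝ) : ℂ)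
      * Complex.exp (((v * Real.cos t : ℝ) : ℂ) + ((y * Real.cos (m * t) : ℝ) : ℂ) * Complex.I)) μI := by
    intro b
    have hc : Continuous (fun t : ℝ => (((Real.cos t) ^ b : ℝ) : ℂ)
        * Complex.exp (((v * Real.cos t : ℝ) : ℂ) + ((y * Real.cos (m * t) : ℝ) : ℂ) * Complex.I)) := by
      fun_prop
    exact hc.continuousOn.integrableOn_compact isCompact_Icc
  rw [← integral_sub (hint a) (hint (a + 2))]
  refine integral_congr_ae (ae_of_all _ fun t => ?_)
  simp only [Real.sin_sq]
  push_cast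
  ring

/-- The binomial coefficients of `(cos t)^a` have 1-norm one: `Σ_{s=0}^{a} ‖C(a,s)/2^a‖ = 1`. [folklore] -/
private theorem sum_norm_choose_div_two_pow (a : ℕ) :
    ∑ s ∈ Finset.range (a + 1), ‖((a.choose s : ℂ) / 2 ^ a)‖ = 1 := by
  have h2 : (2 : ℝ) ^ a ≠ 0 := pow_ne_zero _ two_ne_zero
  simp_rw [norm_div, norm_pow, Complex.norm_natCast, Complex.norm_ofNat]
  rw [← Finset.sum_div, ← Nat.cast_sum, Nat.sum_range_choose, Nat.cast_pow, Nat.cast_ofNat,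
    div_self h2]

/-- **Two-sided order ball for a `cos^a`-inserted row.** For `v ≥ 0`, `m ≠ 0`, `a ≤ (J+1)|m|`, with
`W^{(a)}_j(v) = 2^{-a} Σ_s C(a,s) I_{jm-(2s-a)}(v)` and `F_j = 2π i^{|j|} J_{|j|}(y)`:
`‖T^{(a)}_m(v,y) + W_0 F_0 − Σ_{n ≤ J}(W_n F_n + W_{-n} F_{-n})‖ ≤ 4π I_{(J+1)|m|-a}(v) Σ_{l ≥ J+1} |J_l(y)|`
— truncating a cosine-power row at twist order `J` costs ONE shifted plain Bessel weight times the
`J`-tail (the insertion's coefficient 1-norm is `1`).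
[cite: DLMF, 10.35.2; DLMF, 10.14.4; Watson1944, §3.71; FitznerVanDerHofstad2016NoBLE, §5.1.1 (5.2)–(5.4)] -/
theorem norm_cosPowRow_add_sub_sum_range_le {v : ℝ} (hv : 0 ≤ v) (y : ℝ) {m : ℤ} (hm : m ≠ 0)
    (a J : ℕ) (haJ : a ≤ (J + 1) * m.natAbs) :
    ‖(∫ t, (((Real.cos t) ^ a : ℝ) : ℂ)
        * Complex.exp (((v * Real.cos t : ℝ) : ℂ) + ((y * Real.cos (m * t) : ℝ) : ℂ) * Complex.I) ∂μI)
      + (∑ s ∈ Finset.range (a + 1),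
            ((a.choose s : ℂ) / 2 ^ a) * (besselI (0 * m - ((2 * (s : ℤ) - a : ℤ))) v : ℂ))
          * (2 * π * Complex.I ^ (0 : ℤ).natAbs * (besselJ (0 : ℤ).natAbs y : ℂ))
      - ∑ n ∈ Finset.range (J + 1),
          ((∑ s ∈ Finset.range (a + 1),
              ((a.choose s : ℂ) / 2 ^ a) * (besselI (n * m - ((2 * (s : ℤ) - a : ℤ))) v : ℂ))
              * (2 * π * Complex.I ^ (n : ℤ).natAbs * (besselJ (n : ℤ).natAbs y : ℂ))
            + (∑ s ∈ Finset.range (a + 1),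
              ((a.choose s : ℂ) / 2 ^ a) * (besselI (-(n : ℤ) * m - ((2 * (s : ℤ) - a : ℤ))) v : ℂ))
              * (2 * π * Complex.I ^ (-(n : ℤ)).natAbs * (besselJ (-(n : ℤ)).natAbs y : ℂ)))‖
      ≤ 4 * π * besselI ((((J + 1) * m.natAbs - a : ℕ)) : ℤ) v * ∑' l : ℕ, |besselJ (l + J + 1) y| := by
  have hρ : ∀ s ∈ Finset.range (a + 1), ((2 * (s : ℤ) - a : ℤ)).natAbs ≤ a := by
    intro s hs
    have hs' : s ≤ a := Nat.lt_succ_iff.mp (Finset.mem_range.mp hs)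
    omega
  have h := norm_insertedFamily_add_sub_sum_range_le (Finset.range (a + 1))
    (fun s : ℕ => (2 * (s : ℤ) - a : ℤ)) (fun s : ℕ => ((a.choose s : ℂ) / 2 ^ a)) hv y hm hρ haJ
  have hfun : (fun t : ℝ => (∑ s ∈ Finset.range (a + 1), ((a.choose s : ℂ) / 2 ^ a)
        * Complex.exp ((((2 * (s : ℤ) - a : ℤ)) : ℂ) * t * Complex.I))
        * Complex.exp (((v * Real.cos t : ℝ) : ℂ) + ((y * Real.cos (m * t) : ℝ) : ℂ) * Complex.I))
      = fun t : ℝ => (((Real.cos t) ^ a : ℝ) : ℂ)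
        * Complex.exp (((v * Real.cos t : ℝ) : ℂ) + ((y * Real.cos (m * t) : ℝ) : ℂ) * Complex.I) := by
    funext t; rw [ofReal_cos_pow_eq_sum_cexp]
  rw [hfun, sum_norm_choose_div_two_pow, mul_one] at h
  exact h

/-! ### Folding a symmetric row onto `ℕ` (the kernel's row format) -/

/-- **Folding an even `ℤ`-row**: if `Σ_{j∈ℤ} g_j = T` and `g_{-n} = g_n`, then
`Σ_{n∈ℕ} ε_n g_n = T` with `ε_0 = 1`, `ε_n = 2` (`n ≥ 1`). [cite: DLMF, 10.35.2] -/
theorem hasSum_nat_eps_of_hasSum_int_even {g : ℤ → ℂ} {T : ℂ} (hg : HasSum g T)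
    (hsymm : ∀ n : ℕ, g (-(n : ℤ)) = g n) :
    HasSum (fun n : ℕ => (if n = 0 then (1 : ℂ) else 2) * g n) T := by
  have h := hg.nat_add_neg
  have h2 : HasSum (fun n : ℕ => (2 : ℂ) * g n) (T + g 0) := by
    refine h.congr_fun fun n => ?_
    change 2 * g n = g n + g (-(n : ℤ))
    rw [hsymm, two_mul]
  have h0 : HasSum (fun n : ℕ => if n = 0 then g 0 else 0) (g 0) := hasSum_ite_eq 0 (g 0)
  have h3 := h2.sub h0
  rw [add_sub_cancel_right] at h3
  refine h3.congr_fun fun n => ?_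
  change (if n = 0 then (1 : ℂ) else 2) * g n = 2 * g n - (if n = 0 then g 0 else 0)
  rcases Nat.eq_zero_or_pos n with hn0 | hn0
  · subst hn0
    simp only [if_true, Nat.cast_zero]
    ring
  · simp only [if_neg hn0.ne', sub_zero]

/-- The `cos^a` weights are EVEN in the twist index: `W^{(a)}_{-j}(v) = W^{(a)}_j(v)`
(`I_{-b} = I_b` and the reflection `s ↦ a - s` of the binomial sum). [cite: DLMF, 10.35.2] -/
theorem cosPowWeight_neg (a : ℕ) (v : ℝ) (m j : ℤ) :
    ∑ s ∈ Finset.range (a + 1), ((a.choose s : ℂ) / 2 ^ a) * (besselI ((-j) * m - ((2 * (s : ℤ) - a : ℤ))) v : ℂ)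
      = ∑ s ∈ Finset.range (a + 1), ((a.choose s : ℂ) / 2 ^ a) * (besselI (j * m - ((2 * (s : ℤ) - a : ℤ))) v : ℂ) := by
  rw [← Finset.sum_range_reflect]
  refine Finset.sum_congr rfl fun s hs => ?_
  have hs' : s ≤ a := Nat.lt_succ_iff.mp (Finset.mem_range.mp hs)
  rw [show a + 1 - 1 - s = a - s by omega, Nat.choose_symm hs',
    show (-j) * m - ((2 * ((a - s : ℕ) : ℤ) - a : ℤ)) = -(j * m - ((2 * (s : ℤ) - a : ℤ))) by
      push_cast [Nat.cast_sub hs']; ring,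
    Literature.Probability.LatticeModels.besselI_neg_index]

/-- **Folded `cos^a` row** (the kernel's `ℕ`-indexed format): for `m ≠ 0`,
`T^{(a)}_m(v,y) = Σ_{n∈ℕ} ε_n W^{(a)}_n(v) · 2π iⁿ J_n(y)`.
[cite: DLMF, 10.35.2; FitznerVanDerHofstad2016NoBLE, §5.1.1 (5.2)–(5.4)] -/
theorem hasSum_cos_pow_besselRow_nat_μI (a : ℕ) (v y : ℝ) {m : ℤ} (hm : m ≠ 0) :
    HasSum (fun n : ℕ => (if n = 0 then (1 : ℂ) else 2)
        * ((∑ s ∈ Finset.range (a + 1),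
            ((a.choose s : ℂ) / 2 ^ a) * (besselI (n * m - ((2 * (s : ℤ) - a : ℤ))) v : ℂ))
          * (2 * π * Complex.I ^ n * (besselJ n y : ℂ))))
      (∫ t, (((Real.cos t) ^ a : ℝ) : ℂ)
        * Complex.exp (((v * Real.cos t : ℝ) : ℂ) + ((y * Real.cos (m * t) : ℝ) : ℂ) * Complex.I) ∂μI) := by
  have h := hasSum_nat_eps_of_hasSum_int_even (hasSum_cos_pow_besselRow_μI a v y hm) (fun n => by
    simp only [Int.natAbs_neg, Int.natAbs_natCast]
    rw [cosPowWeight_neg])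
  refine h.congr_fun fun n => ?_
  simp only [Int.natAbs_natCast]

/-- Folding a symmetric truncated `ℤ`-row: `Σ_{n≤J}(f_n + f_{-n}) − f_0 = Σ_{n≤J} ε_n f_n`. [folklore] -/
private theorem sum_range_add_neg_sub_eq_sum_eps (f : ℤ → ℂ) (hf : ∀ n : ℕ, f (-(n : ℤ)) = f n)
    (J : ℕ) :
    ∑ n ∈ Finset.range (J + 1), (f n + f (-(n : ℤ))) - f 0
      = ∑ n ∈ Finset.range (J + 1), (if n = 0 then (1 : ℂ) else 2) * f n := by
  have h2 : ∀ n : ℕ, f n + f (-(n : ℤ)) = 2 * f n := fun n => by rw [hf, two_mul]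
  simp_rw [h2]
  rw [Finset.sum_range_succ' (fun n => 2 * f n), Finset.sum_range_succ' (fun n => (if n = 0 then (1 : ℂ) else 2) * f n)]
  simp only [Nat.cast_zero, if_true, one_mul, Nat.succ_ne_zero, if_false]
  ring

/-- **Order ball of the FOLDED `cos^a` row**: for `v ≥ 0`, `m ≠ 0`, `a ≤ (J+1)|m|`,
`‖T^{(a)}_m(v,y) − Σ_{j≤J} ε_j W^{(a)}_j(v)·2π iʲ J_j(y)‖ ≤ 4π I_{(J+1)|m|−a}(v) Σ_{l≥0}|J_{l+J+1}(y)|`.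
[cite: DLMF, 10.35.2, 10.37; FitznerVanDerHofstad2016NoBLE, §5.1.1 (5.2)–(5.5)] -/
theorem norm_cosPowRow_sub_foldTrunc_le {v : ℝ} (hv : 0 ≤ v) (y : ℝ) {m : ℤ} (hm : m ≠ 0)
    (a J : ℕ) (haJ : a ≤ (J + 1) * m.natAbs) :
    ‖(∫ t, (((Real.cos t) ^ a : ℝ) : ℂ)
        * Complex.exp (((v * Real.cos t : ℝ) : ℂ) + ((y * Real.cos (m * t) : ℝ) : ℂ) * Complex.I) ∂μI)
      - ∑ j ∈ Finset.range (J + 1), (if j = 0 then (1 : ℂ) else 2)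
          * ((∑ s ∈ Finset.range (a + 1),
              ((a.choose s : ℂ) / 2 ^ a) * (besselI (j * m - ((2 * (s : ℤ) - a : ℤ))) v : ℂ))
            * (2 * π * Complex.I ^ j * (besselJ j y : ℂ)))‖
      ≤ 4 * π * besselI ((((J + 1) * m.natAbs - a : ℕ)) : ℤ) v * ∑' l : ℕ, |besselJ (l + J + 1) y| := by
  set f : ℤ → ℂ := fun j => (∑ s ∈ Finset.range (a + 1),
      ((a.choose s : ℂ) / 2 ^ a) * (besselI (j * m - ((2 * (s : ℤ) - a : ℤ))) v : ℂ))
        * (2 * π * Complex.I ^ j.natAbs * (besselJ j.natAbs y : ℂ)) with hf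
  have hsymm : ∀ n : ℕ, f (-(n : ℤ)) = f n := fun n => by
    simp only [hf, Int.natAbs_neg, Int.natAbs_natCast]
    rw [cosPowWeight_neg]
  have hfold := sum_range_add_neg_sub_eq_sum_eps f hsymm J
  have h10 := norm_cosPowRow_add_sub_sum_range_le hv y hm a J haJ
  have e : ∑ j ∈ Finset.range (J + 1), (if j = 0 then (1 : ℂ) else 2)
          * ((∑ s ∈ Finset.range (a + 1),
              ((a.choose s : ℂ) / 2 ^ a) * (besselI (j * m - ((2 * (s : ℤ) - a : ℤ))) v : ℂ))
            * (2 * π * Complex.I ^ j * (besselJ j y : ℂ)))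
      = ∑ n ∈ Finset.range (J + 1), (f n + f (-(n : ℤ))) - f 0 := by
    rw [hfold]
    refine Finset.sum_congr rfl fun j _ => ?_
    simp only [hf, Int.natAbs_natCast]
  rw [e, sub_sub_eq_add_sub]
  have e0 : f 0 = (∑ s ∈ Finset.range (a + 1),
      ((a.choose s : ℂ) / 2 ^ a) * (besselI (0 * m - ((2 * (s : ℤ) - a : ℤ))) v : ℂ))
        * (2 * π * Complex.I ^ (0 : ℤ).natAbs * (besselJ (0 : ℤ).natAbs y : ℂ)) := rfl
  rw [e0]
  exact h10

/-! ### The multinomial reduction of `D̂^l` -/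

variable {d : ℕ}

/-- `Π_{t : Fin l} cos k_{p(t)} = Π_μ (cos k_μ)^{#{t : p t = μ}}` (group the factors by coordinate).
[folklore] -/
private theorem prod_cos_comp_eq_prod_cos_pow (l : ℕ) (p : Fin l → Fin d) (k : Fin d → ℝ) :
    ∏ t, Real.cos (k (p t)) = ∏ μ, Real.cos (k μ) ^ (Finset.univ.filter (fun t => p t = μ)).card := by
  rw [← Finset.prod_fiberwise Finset.univ p (fun t => Real.cos (k (p t)))]
  refine Finset.prod_congr rfl fun μ _ => ?_
  rw [Finset.prod_congr rfl (fun t ht => by rw [(Finset.mem_filter.mp ht).2]), Finset.prod_const]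

/-- **Multinomial reduction**: `D̂(k)^l = d^{-l} Σ_{p : Fin l → Fin d} Π_μ (cos k_μ)^{a_μ(p)}` with
`a_μ(p) = #{t : p t = μ}` — the `D̂^l` weight is an average of PRODUCT cosine-power weights.
[cite: FitznerVanDerHofstad2016NoBLE, (3.34)–(3.38) p. 1071, §5.1.1 (5.9)] -/
theorem Dhat_pow_eq_sum_prod_cos_pow (l : ℕ) (k : Fin d → ℝ) :
    Dhat d k ^ l = ((d : ℝ) ^ l)⁻¹ * ∑ p : Fin l → Fin d,
      ∏ μ, Real.cos (k μ) ^ (Finset.univ.filter (fun t => p t = μ)).card := by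
  simp only [Dhat]
  rw [div_pow, Fintype.sum_pow, div_eq_inv_mul]
  congr 1
  exact Finset.sum_congr rfl fun p _ => prod_cos_comp_eq_prod_cos_pow l p k

/-- **Linearity + multinomial at the level of twisted moments**:
`Tw^{D̂^l}_n(x;β) = d^{-l} Σ_{p : Fin l → Fin d} Tw^{Π_μ cos^{a_μ(p)}}_n(x;β)` for `d ≥ 2n+1`, every node
`x` and every `β` — each `D̂^l`-weighted twisted moment is a finite average of PRODUCT cos-power twisted
moments (multiplicities `a_μ(p) = #{t : p t = μ} ≤ l`), to which the row-truncation theorem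
`abs_srwTwist_prodCosPow_sub_rowTrunc_le_sum_srwI` applies termwise.
[cite: FitznerVanDerHofstad2016NoBLE, (3.34)–(3.38) p. 1071, §5.1.1 (5.2)–(5.5)] -/
theorem srwTwist_Dhat_pow_eq_sum_srwTwist_prodCosPow {n : ℕ} (hd : 2 * n + 1 ≤ d) (x : Fin d → ℤ)
    (β : ℝ) (l : ℕ) :
    srwTwist d n (fun k => Dhat d k ^ l) x β
      = ((d : ℝ) ^ l)⁻¹ * ∑ p : Fin l → Fin d,
          srwTwist d n (fun k => ∏ μ, Real.cos (k μ) ^ (Finset.univ.filter (fun t => p t = μ)).card)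
            x β := by
  have hw : (fun k : Fin d → ℝ => Dhat d k ^ l) = fun k => ∑ p : Fin l → Fin d,
      ((d : ℝ) ^ l)⁻¹ * ∏ μ, Real.cos (k μ) ^ (Finset.univ.filter (fun s => p s = μ)).card := by
    funext k
    rw [Dhat_pow_eq_sum_prod_cos_pow, Finset.mul_sum]
  have h1 : ∀ p : Fin l → Fin d, ∀ μ : Fin d, ∀ t : ℝ,
      |Real.cos t ^ (Finset.univ.filter (fun s => p s = μ)).card| ≤ 1 := by
    intro p μ t
    rw [abs_pow]
    exact pow_le_one₀ (abs_nonneg _) (abs_cos_le_one t)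
  rw [hw, srwTwist_sum_weight (Finset.univ) (fun _ => ((d : ℝ) ^ l)⁻¹)
    (fun (p : Fin l → Fin d) (k : Fin d → ℝ) =>
      ∏ μ, Real.cos (k μ) ^ (Finset.univ.filter (fun s => p s = μ)).card) hd
    (fun p _ => by fun_prop)
    (fun p _ => ⟨1, fun k => by
      rw [Finset.abs_prod]
      exact Finset.prod_le_one (fun _ _ => abs_nonneg _) (fun μ _ => h1 p μ (k μ))⟩),
    ← Finset.mul_sum]

/-- For even `l`, `|D̂|^l = D̂^l`: the `|D̂|^l`-weighted twisted moment is the same finite average of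
product cos-power twisted moments. [cite: FitznerVanDerHofstad2016NoBLE, (3.34)–(3.38) p. 1071] -/
theorem srwTwist_abs_Dhat_pow_eq_sum_srwTwist_prodCosPow_of_even {n : ℕ} (hd : 2 * n + 1 ≤ d)
    (x : Fin d → ℤ) (β : ℝ) {l : ℕ} (hl : Even l) :
    srwTwist d n (fun k => |Dhat d k| ^ l) x β
      = ((d : ℝ) ^ l)⁻¹ * ∑ p : Fin l → Fin d,
          srwTwist d n (fun k => ∏ μ, Real.cos (k μ) ^ (Finset.univ.filter (fun t => p t = μ)).card)
            x β := by
  have hw : (fun k : Fin d → ℝ => |Dhat d k| ^ l) = fun k => Dhat d k ^ l := by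
    funext k; exact hl.pow_abs _
  rw [hw]
  exact srwTwist_Dhat_pow_eq_sum_srwTwist_prodCosPow hd x β l

/-- **`u`-representation of the `D̂^l`-weighted twisted moment at an axis node.** For `d ≥ 2n+3`,
`srwTwist d (n+1) (D̂^l) (m e_i) β = d^{-l} Σ_{p : Fin l → Fin d} (n!)⁻¹ ∫_0^∞ τ^n e^{-τ}
 Re Π_μ T^{(a_μ(p))}_m(τ/d, β/d) dτ / (2π)^d` with the cosine-power rows
`T^{(a)}_m(v,y) = ∫_{[-π,π]} (cos t)^a e^{v cos t + iy cos(mt)} dt` (`a_μ(p) = #{t : p t = μ}`):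
the multinomial reduction, linearity of `srwTwist` in the weight, and the product-weight
Schwinger–Fubini form. [cite: FitznerVanDerHofstad2016NoBLE, (3.34)–(3.38) p. 1071, §5.1.1 (5.2)–(5.5), (5.9) p. 1092; DLMF, 10.32.1] -/
theorem srwTwist_succ_Dhat_pow_single_eq (n : ℕ) (hd : 2 * (n + 1) + 1 ≤ d) (i : Fin d) (m : ℤ)
    (β : ℝ) (l : ℕ) :
    srwTwist d (n + 1) (fun k => Dhat d k ^ l) (Pi.single i m) β
      = ((d : ℝ) ^ l)⁻¹ * ∑ p : Fin l → Fin d, ((n ! : ℝ)⁻¹ * (∫ τ in Ioi (0:ℝ), τ ^ n * (Real.exp (-τ) *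
          (∏ μ, ∫ t, ((((Real.cos t) ^ (Finset.univ.filter (fun s => p s = μ)).card : ℝ)) : ℂ)
            * Complex.exp (((τ / d * Real.cos t : ℝ) : ℂ)
              + ((β / d * Real.cos (m * t) : ℝ) : ℂ) * Complex.I) ∂μI).re)) / (2 * π) ^ d) := by
  have hw : (fun k : Fin d → ℝ => Dhat d k ^ l) = fun k => ∑ p : Fin l → Fin d,
      ((d : ℝ) ^ l)⁻¹ * ∏ μ, Real.cos (k μ) ^ (Finset.univ.filter (fun s => p s = μ)).card := by
    funext k
    rw [Dhat_pow_eq_sum_prod_cos_pow, Finset.mul_sum]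
  have h1 : ∀ p : Fin l → Fin d, ∀ μ : Fin d, ∀ t : ℝ,
      |Real.cos t ^ (Finset.univ.filter (fun s => p s = μ)).card| ≤ 1 := by
    intro p μ t
    rw [abs_pow]
    exact pow_le_one₀ (abs_nonneg _) (abs_cos_le_one t)
  rw [hw, srwTwist_sum_weight (Finset.univ) (fun _ => ((d : ℝ) ^ l)⁻¹)
    (fun (p : Fin l → Fin d) (k : Fin d → ℝ) =>
      ∏ μ, Real.cos (k μ) ^ (Finset.univ.filter (fun s => p s = μ)).card) hd
    (fun p _ => by fun_prop)
    (fun p _ => ⟨1, fun k => by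
      rw [Finset.abs_prod]
      exact Finset.prod_le_one (fun _ _ => abs_nonneg _) (fun μ _ => h1 p μ (k μ))⟩),
    ← Finset.mul_sum]
  congr 1
  refine Finset.sum_congr rfl fun p _ => ?_
  have h := srwTwist_succ_prod_single_eq_integral n hd i m β
    (fun μ t => Real.cos t ^ (Finset.univ.filter (fun s => p s = μ)).card)
    (fun μ => by fun_prop) (h1 p)
  rw [h]

/-- For even `l`, `|D̂|^l = D̂^l`, so the `|D̂|^l`-weighted twisted moment (the weight of the `K`- and
`U`-type bubble moments) has the same `u`-representation.
[cite: FitznerVanDerHofstad2016NoBLE, (3.34)–(3.38) p. 1071, §5.1.1 (5.9) p. 1092] -/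
theorem srwTwist_succ_abs_Dhat_pow_single_eq_of_even (n : ℕ) (hd : 2 * (n + 1) + 1 ≤ d) (i : Fin d)
    (m : ℤ) (β : ℝ) {l : ℕ} (hl : Even l) :
    srwTwist d (n + 1) (fun k => |Dhat d k| ^ l) (Pi.single i m) β
      = ((d : ℝ) ^ l)⁻¹ * ∑ p : Fin l → Fin d, ((n ! : ℝ)⁻¹ * (∫ τ in Ioi (0:ℝ), τ ^ n * (Real.exp (-τ) *
          (∏ μ, ∫ t, ((((Real.cos t) ^ (Finset.univ.filter (fun s => p s = μ)).card : ℝ)) : ℂ)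
            * Complex.exp (((τ / d * Real.cos t : ℝ) : ℂ)
              + ((β / d * Real.cos (m * t) : ℝ) : ℂ) * Complex.I) ∂μI).re)) / (2 * π) ^ d) := by
  have hw : (fun k : Fin d → ℝ => |Dhat d k| ^ l) = fun k => Dhat d k ^ l := by
    funext k; exact hl.pow_abs _
  rw [hw]
  exact srwTwist_succ_Dhat_pow_single_eq n hd i m β l


/-- `D̂(k)^l · D̂^{sin}(k) = d^{-l} d^{-2} Σ_j Σ_{p : Fin l → Fin d} Π_μ (cos k_μ)^{a_μ(p)} · [μ = j] sin² k_μ`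
— the `D̂^l D̂^{sin}` weight (the `U`-type bubble moment) is an average of product weights with ONE
`sin²` inserted. [cite: FitznerVanDerHofstad2016NoBLE, §3.3.3 p. 1070, (3.34)–(3.38) p. 1071, §5.1.1 (5.9)] -/
theorem Dhat_pow_mul_Dsin_eq_sum (l : ℕ) (k : Fin d → ℝ) :
    Dhat d k ^ l * Dsin d k = ((d : ℝ) ^ l)⁻¹ * (((d : ℝ) ^ 2)⁻¹ * ∑ j : Fin d, ∑ p : Fin l → Fin d,
      ∏ μ, (Real.cos (k μ) ^ (Finset.univ.filter (fun t => p t = μ)).card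
        * (if μ = j then Real.sin (k μ) ^ 2 else 1))) := by
  have hprod : ∀ (j : Fin d) (p : Fin l → Fin d),
      ∏ μ, (Real.cos (k μ) ^ (Finset.univ.filter (fun t => p t = μ)).card
        * (if μ = j then Real.sin (k μ) ^ 2 else 1))
      = (∏ μ, Real.cos (k μ) ^ (Finset.univ.filter (fun t => p t = μ)).card) * Real.sin (k j) ^ 2 := by
    intro j p
    rw [Finset.prod_mul_distrib, Finset.prod_ite_eq']
    simp
  simp_rw [hprod]
  rw [Dhat_pow_eq_sum_prod_cos_pow, Dsin]
  simp_rw [← Finset.sum_mul]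
  rw [← Finset.mul_sum]
  ring

/-- **`u`-representation of the `D̂^l D̂^{sin}`-weighted twisted moment at an axis node** (`d ≥ 2n+3`):
`srwTwist d (n+1) (D̂^l D̂^{sin}) (m e_i) β = d^{-l} d^{-2} Σ_j Σ_p (n!)⁻¹ ∫_0^∞ τ^n e^{-τ}
 Re Π_μ (∫ g^{p,j}_μ(t) e^{(τ/d) cos t + i(β/d) cos(mt)} dt) dτ / (2π)^d`, with
`g^{p,j}_μ = cos^{a_μ(p)}` for `μ ≠ j` and `cos^{a_j(p)} sin²` at `μ = j` (whose row is
`T^{(a)} − T^{(a+2)}`, `integral_cos_pow_mul_sin_sq_row_eq_sub`).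
[cite: FitznerVanDerHofstad2016NoBLE, §3.3.3 p. 1070, (3.34)–(3.38) p. 1071, §5.1.1 (5.2)–(5.5), (5.9) p. 1092; DLMF, 10.32.1] -/
theorem srwTwist_succ_Dhat_pow_mul_Dsin_single_eq (n : ℕ) (hd : 2 * (n + 1) + 1 ≤ d) (i : Fin d)
    (m : ℤ) (β : ℝ) (l : ℕ) :
    srwTwist d (n + 1) (fun k => Dhat d k ^ l * Dsin d k) (Pi.single i m) β
      = ((d : ℝ) ^ l)⁻¹ * (((d : ℝ) ^ 2)⁻¹ * ∑ j : Fin d, ∑ p : Fin l → Fin d,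
          ((n ! : ℝ)⁻¹ * (∫ τ in Ioi (0:ℝ), τ ^ n * (Real.exp (-τ) *
          (∏ μ, ∫ t, (((Real.cos t) ^ (Finset.univ.filter (fun s => p s = μ)).card
              * (if μ = j then Real.sin t ^ 2 else 1) : ℝ) : ℂ)
            * Complex.exp (((τ / d * Real.cos t : ℝ) : ℂ)
              + ((β / d * Real.cos (m * t) : ℝ) : ℂ) * Complex.I) ∂μI).re)) / (2 * π) ^ d)) := by
  -- the weight as ONE finite sum over pairs `(j, p)` of scaled product weights
  have hw : (fun k : Fin d → ℝ => Dhat d k ^ l * Dsin d k) = fun k => ∑ x : Fin d × (Fin l → Fin d),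
      (((d : ℝ) ^ l)⁻¹ * ((d : ℝ) ^ 2)⁻¹) * ∏ μ, (Real.cos (k μ) ^ (Finset.univ.filter (fun t => x.2 t = μ)).card
        * (if μ = x.1 then Real.sin (k μ) ^ 2 else 1)) := by
    funext k
    rw [Dhat_pow_mul_Dsin_eq_sum, Fintype.sum_prod_type, ← mul_assoc, Finset.mul_sum]
    simp_rw [Finset.mul_sum]
  have h1 : ∀ (x : Fin d × (Fin l → Fin d)) (μ : Fin d) (t : ℝ),
      |Real.cos t ^ (Finset.univ.filter (fun s => x.2 s = μ)).card
        * (if μ = x.1 then Real.sin t ^ 2 else 1)| ≤ 1 := by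
    intro x μ t
    rw [abs_mul, abs_pow]
    refine mul_le_one₀ (pow_le_one₀ (abs_nonneg _) (abs_cos_le_one t)) (abs_nonneg _) ?_
    split_ifs
    · rw [abs_of_nonneg (sq_nonneg _)]; exact Real.sin_sq_le_one t
    · simp
  rw [hw, srwTwist_sum_weight (Finset.univ) (fun _ => ((d : ℝ) ^ l)⁻¹ * ((d : ℝ) ^ 2)⁻¹)
    (fun (x : Fin d × (Fin l → Fin d)) (k : Fin d → ℝ) =>
      ∏ μ, (Real.cos (k μ) ^ (Finset.univ.filter (fun t => x.2 t = μ)).card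
        * (if μ = x.1 then Real.sin (k μ) ^ 2 else 1))) hd
    (fun x _ => by
      refine Finset.measurable_prod _ fun μ _ => ?_
      split_ifs <;> fun_prop)
    (fun x _ => ⟨1, fun k => by
      rw [Finset.abs_prod]
      exact Finset.prod_le_one (fun _ _ => abs_nonneg _) (fun μ _ => h1 x μ (k μ))⟩),
    ← Finset.mul_sum, mul_assoc, Fintype.sum_prod_type]
  congr 2
  refine Finset.sum_congr rfl fun j _ => Finset.sum_congr rfl fun p _ => ?_
  try dsimp only
  have h := srwTwist_succ_prod_single_eq_integral n hd i m β
    (fun μ t => Real.cos t ^ (Finset.univ.filter (fun s => p s = μ)).card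
      * (if μ = j then Real.sin t ^ 2 else 1))
    (fun μ => by
      show Continuous fun t : ℝ => Real.cos t ^ (Finset.univ.filter (fun s => p s = μ)).card
        * (if μ = j then Real.sin t ^ 2 else 1)
      split_ifs <;> fun_prop) (h1 (j, p))
  rw [h]


/-- **`cos^a sin⁴`-inserted row** (two `D̂^{sin}` insertions at the same coordinate):
`∫ (cos t)^a sin²t sin²t · e^{v cos t + iy cos(mt)} dt = T^{(a)} − 2 T^{(a+2)} + T^{(a+4)}`.
[cite: FitznerVanDerHofstad2016NoBLE, §3.3.3 p. 1070, §5.1.1 (5.2)–(5.4); DLMF, 10.35.2] -/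
theorem integral_cos_pow_mul_sin_sq_mul_sin_sq_row_eq (a : ℕ) (v y : ℝ) (m : ℤ) :
    ∫ t, (((Real.cos t) ^ a * (Real.sin t) ^ 2 * (Real.sin t) ^ 2 : ℝ) : ℂ)
        * Complex.exp (((v * Real.cos t : ℝ) : ℂ) + ((y * Real.cos (m * t) : ℝ) : ℂ) * Complex.I) ∂μI
      = (∫ t, (((Real.cos t) ^ a : ℝ) : ℂ)
          * Complex.exp (((v * Real.cos t : ℝ) : ℂ) + ((y * Real.cos (m * t) : ℝ) : ℂ) * Complex.I) ∂μI)
        - 2 * (∫ t, (((Real.cos t) ^ (a + 2) : ℝ) : ℂ)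
          * Complex.exp (((v * Real.cos t : ℝ) : ℂ) + ((y * Real.cos (m * t) : ℝ) : ℂ) * Complex.I) ∂μI)
        + ∫ t, (((Real.cos t) ^ (a + 4) : ℝ) : ℂ)
          * Complex.exp (((v * Real.cos t : ℝ) : ℂ) + ((y * Real.cos (m * t) : ℝ) : ℂ) * Complex.I) ∂μI := by
  have hint : ∀ b : ℕ, Integrable (fun t : ℝ => (((Real.cos t) ^ b : ℝ) : ℂ)
      * Complex.exp (((v * Real.cos t : ℝ) : ℂ) + ((y * Real.cos (m * t) : ℝ) : ℂ) * Complex.I)) μI := by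
    intro b
    have hc : Continuous (fun t : ℝ => (((Real.cos t) ^ b : ℝ) : ℂ)
        * Complex.exp (((v * Real.cos t : ℝ) : ℂ) + ((y * Real.cos (m * t) : ℝ) : ℂ) * Complex.I)) := by
      fun_prop
    exact hc.continuousOn.integrableOn_compact isCompact_Icc
  have hpt : ∀ t : ℝ, (((Real.cos t) ^ a * (Real.sin t) ^ 2 * (Real.sin t) ^ 2 : ℝ) : ℂ)
        * Complex.exp (((v * Real.cos t : ℝ) : ℂ) + ((y * Real.cos (m * t) : ℝ) : ℂ) * Complex.I)
      = ((((Real.cos t) ^ a : ℝ) : ℂ)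
          * Complex.exp (((v * Real.cos t : ℝ) : ℂ) + ((y * Real.cos (m * t) : ℝ) : ℂ) * Complex.I)
        - 2 * ((((Real.cos t) ^ (a + 2) : ℝ) : ℂ)
          * Complex.exp (((v * Real.cos t : ℝ) : ℂ) + ((y * Real.cos (m * t) : ℝ) : ℂ) * Complex.I)))
        + (((Real.cos t) ^ (a + 4) : ℝ) : ℂ)
          * Complex.exp (((v * Real.cos t : ℝ) : ℂ) + ((y * Real.cos (m * t) : ℝ) : ℂ) * Complex.I) := by
    intro t
    simp only [Real.sin_sq]
    push_cast
    ring
  simp_rw [hpt]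
  have hAB : Integrable (fun t : ℝ => (((Real.cos t) ^ a : ℝ) : ℂ)
          * Complex.exp (((v * Real.cos t : ℝ) : ℂ) + ((y * Real.cos (m * t) : ℝ) : ℂ) * Complex.I)
        - 2 * ((((Real.cos t) ^ (a + 2) : ℝ) : ℂ)
          * Complex.exp (((v * Real.cos t : ℝ) : ℂ) + ((y * Real.cos (m * t) : ℝ) : ℂ) * Complex.I))) μI :=
    (hint a).sub ((hint (a + 2)).const_mul 2)
  rw [integral_add hAB (hint (a + 4)), integral_sub (hint a) ((hint (a + 2)).const_mul 2),
    integral_const_mul]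

/-- `D̂(k)^l · D̂^{sin}(k)² = d^{-l} d^{-2} d^{-2} Σ_j Σ_{j'} Σ_p Π_μ (cos k_μ)^{a_μ(p)} [μ=j]sin²k_μ [μ=j']sin²k_μ`
— the `(D̂^{sin})²` weight is an average of product weights with TWO `sin²` insertions.
[cite: FitznerVanDerHofstad2016NoBLE, §3.3.3 p. 1070, (3.34)–(3.38) p. 1071, §5.2 (5.9), (5.14) p. 1092] -/
theorem Dhat_pow_mul_Dsin_sq_eq_sum (l : ℕ) (k : Fin d → ℝ) :
    Dhat d k ^ l * Dsin d k ^ 2 = ((d : ℝ) ^ l)⁻¹ * (((d : ℝ) ^ 2)⁻¹ * (((d : ℝ) ^ 2)⁻¹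
      * ∑ j : Fin d, ∑ j' : Fin d, ∑ p : Fin l → Fin d,
        ∏ μ, (Real.cos (k μ) ^ (Finset.univ.filter (fun t => p t = μ)).card
          * (if μ = j then Real.sin (k μ) ^ 2 else 1) * (if μ = j' then Real.sin (k μ) ^ 2 else 1)))) := by
  have hprod : ∀ (j j' : Fin d) (p : Fin l → Fin d),
      ∏ μ, (Real.cos (k μ) ^ (Finset.univ.filter (fun t => p t = μ)).card
        * (if μ = j then Real.sin (k μ) ^ 2 else 1) * (if μ = j' then Real.sin (k μ) ^ 2 else 1))
      = Real.sin (k j) ^ 2 * Real.sin (k j') ^ 2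
          * ∏ μ, Real.cos (k μ) ^ (Finset.univ.filter (fun t => p t = μ)).card := by
    intro j j' p
    rw [Finset.prod_mul_distrib, Finset.prod_mul_distrib, Finset.prod_ite_eq', Finset.prod_ite_eq']
    simp only [Finset.mem_univ, if_true]
    ring
  simp_rw [hprod]
  rw [Dhat_pow_eq_sum_prod_cos_pow, Dsin]
  simp only [← Finset.mul_sum, ← Finset.sum_mul]
  ring

/-- **`u`-representation of the `D̂^l (D̂^{sin})²`-weighted twisted moment at an axis node** (`d ≥ 2n+3`):
the average over `(j, j', p)` of `u`-integrals of products over the coordinates of the rows with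
`cos^{a_μ(p)}` inserted and a `sin²` inserted at `μ = j` and at `μ = j'` (factor rows
`integral_cos_pow_mul_sin_sq_row_eq_sub`, `integral_cos_pow_mul_sin_sq_mul_sin_sq_row_eq`).
[cite: FitznerVanDerHofstad2016NoBLE, §3.3.3 p. 1070, (3.34)–(3.38) p. 1071, §5.1.1 (5.2)–(5.5), §5.2 (5.9), (5.14) p. 1092; DLMF, 10.32.1] -/
theorem srwTwist_succ_Dhat_pow_mul_Dsin_sq_single_eq (n : ℕ) (hd : 2 * (n + 1) + 1 ≤ d) (i : Fin d)
    (m : ℤ) (β : ℝ) (l : ℕ) :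
    srwTwist d (n + 1) (fun k => Dhat d k ^ l * Dsin d k ^ 2) (Pi.single i m) β
      = ((d : ℝ) ^ l)⁻¹ * (((d : ℝ) ^ 2)⁻¹ * (((d : ℝ) ^ 2)⁻¹
          * ∑ j : Fin d, ∑ j' : Fin d, ∑ p : Fin l → Fin d,
          ((n ! : ℝ)⁻¹ * (∫ τ in Ioi (0:ℝ), τ ^ n * (Real.exp (-τ) *
          (∏ μ, ∫ t, (((Real.cos t) ^ (Finset.univ.filter (fun s => p s = μ)).card
              * (if μ = j then Real.sin t ^ 2 else 1) * (if μ = j' then Real.sin t ^ 2 else 1) : ℝ) : ℂ)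
            * Complex.exp (((τ / d * Real.cos t : ℝ) : ℂ)
              + ((β / d * Real.cos (m * t) : ℝ) : ℂ) * Complex.I) ∂μI).re)) / (2 * π) ^ d))) := by
  have hw : (fun k : Fin d → ℝ => Dhat d k ^ l * Dsin d k ^ 2)
      = fun k => ∑ x : Fin d × Fin d × (Fin l → Fin d),
      (((d : ℝ) ^ l)⁻¹ * (((d : ℝ) ^ 2)⁻¹ * ((d : ℝ) ^ 2)⁻¹))
        * ∏ μ, (Real.cos (k μ) ^ (Finset.univ.filter (fun t => x.2.2 t = μ)).card
          * (if μ = x.1 then Real.sin (k μ) ^ 2 else 1) * (if μ = x.2.1 then Real.sin (k μ) ^ 2 else 1)) := by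
    funext k
    rw [Dhat_pow_mul_Dsin_sq_eq_sum, Fintype.sum_prod_type]
    simp_rw [Fintype.sum_prod_type]
    rw [← mul_assoc, ← mul_assoc, Finset.mul_sum]
    simp_rw [Finset.mul_sum]
    congr 1; funext j; congr 1; funext j'; congr 1; funext p
    ring
  have h1 : ∀ (x : Fin d × Fin d × (Fin l → Fin d)) (μ : Fin d) (t : ℝ),
      |Real.cos t ^ (Finset.univ.filter (fun s => x.2.2 s = μ)).card
        * (if μ = x.1 then Real.sin t ^ 2 else 1) * (if μ = x.2.1 then Real.sin t ^ 2 else 1)| ≤ 1 := by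
    intro x μ t
    have hs1 : |(if μ = x.1 then Real.sin t ^ 2 else 1)| ≤ 1 := by
      split_ifs
      · rw [abs_of_nonneg (sq_nonneg _)]; exact Real.sin_sq_le_one t
      · simp
    have hs2 : |(if μ = x.2.1 then Real.sin t ^ 2 else 1)| ≤ 1 := by
      split_ifs
      · rw [abs_of_nonneg (sq_nonneg _)]; exact Real.sin_sq_le_one t
      · simp
    rw [abs_mul, abs_mul, abs_pow]
    exact mul_le_one₀ (mul_le_one₀ (pow_le_one₀ (abs_nonneg _) (abs_cos_le_one t)) (abs_nonneg _) hs1)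
      (abs_nonneg _) hs2
  rw [hw, srwTwist_sum_weight (Finset.univ) (fun _ => ((d : ℝ) ^ l)⁻¹ * (((d : ℝ) ^ 2)⁻¹ * ((d : ℝ) ^ 2)⁻¹))
    (fun (x : Fin d × Fin d × (Fin l → Fin d)) (k : Fin d → ℝ) =>
      ∏ μ, (Real.cos (k μ) ^ (Finset.univ.filter (fun t => x.2.2 t = μ)).card
        * (if μ = x.1 then Real.sin (k μ) ^ 2 else 1) * (if μ = x.2.1 then Real.sin (k μ) ^ 2 else 1))) hd
    (fun x _ => by
      refine Finset.measurable_prod _ fun μ _ => ?_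
      split_ifs <;> fun_prop)
    (fun x _ => ⟨1, fun k => by
      rw [Finset.abs_prod]
      exact Finset.prod_le_one (fun _ _ => abs_nonneg _) (fun μ _ => h1 x μ (k μ))⟩),
    ← Finset.mul_sum, mul_assoc, mul_assoc, Fintype.sum_prod_type]
  simp_rw [Fintype.sum_prod_type]
  congr 3
  refine Finset.sum_congr rfl fun j _ => Finset.sum_congr rfl fun j' _ => Finset.sum_congr rfl fun p _ => ?_
  try dsimp only
  have h := srwTwist_succ_prod_single_eq_integral n hd i m β
    (fun μ t => Real.cos t ^ (Finset.univ.filter (fun s => p s = μ)).card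
      * (if μ = j then Real.sin t ^ 2 else 1) * (if μ = j' then Real.sin t ^ 2 else 1))
    (fun μ => by
      show Continuous fun t : ℝ => Real.cos t ^ (Finset.univ.filter (fun s => p s = μ)).card
        * (if μ = j then Real.sin t ^ 2 else 1) * (if μ = j' then Real.sin t ^ 2 else 1)
      split_ifs <;> fun_prop) (h1 (j, j', p))
  rw [h]

/-! ### The `M̂²` insertion: reduction to `D̂`-polynomial × `D̂^{sin}`-power weights -/

/-- A factor `Ĉ^j` in the weight shifts the Schwinger order: `Tw^{w Ĉ^j}_n = Tw^w_{n+j}`.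
[cite: FitznerVanDerHofstad2016NoBLE, (3.34) p. 1071, §5.1.1 (5.5)] -/
theorem srwTwist_weight_mul_Chat_pow_eq (n j : ℕ) (w : (Fin d → ℝ) → ℝ) (x : Fin d → ℤ) (β : ℝ) :
    srwTwist d n (fun k => w k * Chat d 1 k ^ j) x β = srwTwist d (n + j) w x β := by
  simp only [srwTwist]
  congr 1
  refine integral_congr_ae (ae_of_all _ fun k => ?_)
  simp only [pow_add]
  ring

/-- `Tw^w_n(x;β)` is additive in the weight (given integrability of both integrands).
[cite: FitznerVanDerHofstad2016NoBLE, (3.34) p. 1071] -/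
theorem srwTwist_add_weight {n : ℕ} (w₁ w₂ : (Fin d → ℝ) → ℝ) (x : Fin d → ℤ) (β : ℝ)
    (h₁ : Integrable (fun k => (w₁ k * Real.cos (β * DhatSym d x k)) * Chat d 1 k ^ n) (P d))
    (h₂ : Integrable (fun k => (w₂ k * Real.cos (β * DhatSym d x k)) * Chat d 1 k ^ n) (P d)) :
    srwTwist d n (fun k => w₁ k + w₂ k) x β = srwTwist d n w₁ x β + srwTwist d n w₂ x β := by
  simp only [srwTwist]
  rw [← add_div, ← integral_add h₁ h₂]
  congr 1
  refine integral_congr_ae (ae_of_all _ fun k => ?_)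
  ring

/-- `Tw^{c w}_n(x;β) = c · Tw^w_n(x;β)`. [cite: FitznerVanDerHofstad2016NoBLE, (3.34) p. 1071] -/
theorem srwTwist_const_mul_weight {n : ℕ} (c : ℝ) (w : (Fin d → ℝ) → ℝ) (x : Fin d → ℤ) (β : ℝ) :
    srwTwist d n (fun k => c * w k) x β = c * srwTwist d n w x β := by
  simp only [srwTwist]
  rw [mul_div_assoc', ← integral_const_mul]
  congr 1
  refine integral_congr_ae (ae_of_all _ fun k => ?_)
  ring

/-- **The `M̂²` insertion at shifted Schwinger order.** For a bounded measurable weight `w` and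
`d ≥ 2n + 5`: since `M̂ = D̂ − 2 D̂^{sin} Ĉ`,
`Tw^{w M̂²}_n(x;β) = Tw^{w D̂²}_n(x;β) − 4 Tw^{w D̂ D̂^{sin}}_{n+1}(x;β) + 4 Tw^{w (D̂^{sin})²}_{n+2}(x;β)` —
the `M̂²`-weighted twisted moments (weight `|D̂|^l M̂²` of the `KM₂` rows) are signed combinations of
twisted moments with `D̂`-polynomial × `D̂^{sin}`-power weights, to which the multinomial reduction applies.
[cite: FitznerVanDerHofstad2016NoBLE, §3.3.3 p. 1070, (3.34)–(3.38) p. 1071, §5.2 (5.9), (5.14) p. 1092] -/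
theorem srwTwist_weight_mul_Mhat_sq_eq {n : ℕ} (hd : 2 * (n + 2) + 1 ≤ d) {w : (Fin d → ℝ) → ℝ}
    (hw : Measurable w) {W : ℝ} (hw1 : ∀ k, |w k| ≤ W) (x : Fin d → ℤ) (β : ℝ) :
    srwTwist d n (fun k => w k * Mhat d k ^ 2) x β
      = srwTwist d n (fun k => w k * Dhat d k ^ 2) x β
        - 4 * srwTwist d (n + 1) (fun k => w k * Dhat d k * Dsin d k) x β
        + 4 * srwTwist d (n + 2) (fun k => w k * Dsin d k ^ 2) x β := by
  have hd1 : 1 ≤ d := by omega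
  have hd0 : (1 : ℝ) ≤ d := by exact_mod_cast hd1
  have hDs : ∀ k : Fin d → ℝ, |Dsin d k| ≤ 1 := fun k => by
    rw [abs_of_nonneg (Dsin_nonneg k)]
    exact (Dsin_le_inv hd1 k).trans (by rw [one_div]; exact inv_le_one_of_one_le₀ hd0)
  have hmD : Measurable (Dhat d) := (continuous_Dhat d).measurable
  have hmS : Measurable (Dsin d) := (continuous_Dsin d).measurable
  have hW0 : 0 ≤ W := (abs_nonneg _).trans (hw1 fun _ => 0)
  set A : (Fin d → ℝ) → ℝ := fun k => w k * Dhat d k ^ 2 with hA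
  set B : (Fin d → ℝ) → ℝ := fun k => w k * Dhat d k * Dsin d k with hB
  set C : (Fin d → ℝ) → ℝ := fun k => w k * Dsin d k ^ 2 with hC
  have hA1 : ∀ k, |A k| ≤ W := fun k => by
    rw [hA, abs_mul, abs_pow]
    exact (mul_le_mul (hw1 k) (pow_le_one₀ (abs_nonneg _) (abs_Dhat_le_one k)) (by positivity)
      hW0).trans_eq (mul_one W)
  have hB1 : ∀ k, |B k| ≤ W := fun k => by
    rw [hB, abs_mul, abs_mul]
    calc |w k| * |Dhat d k| * |Dsin d k| ≤ W * 1 * 1 := by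
          gcongr
          · exact hw1 k
          · exact abs_Dhat_le_one k
          · exact hDs k
      _ = W := by ring
  have hC1 : ∀ k, |C k| ≤ W := fun k => by
    rw [hC, abs_mul, abs_pow]
    exact (mul_le_mul (hw1 k) (pow_le_one₀ (abs_nonneg _) (hDs k)) (by positivity)
      hW0).trans_eq (mul_one W)
  have hAm : Measurable A := hw.mul (hmD.pow_const 2)
  have hBm : Measurable B := (hw.mul hmD).mul hmS
  have hCm : Measurable C := hw.mul (hmS.pow_const 2)
  have hiA := integrable_weight_cos_mul_Chat_pow (n := n) (by omega) hAm hA1 x β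
  have hiB' := integrable_weight_cos_mul_Chat_pow (n := n + 1) (by omega) hBm hB1 x β
  have hiC' := integrable_weight_cos_mul_Chat_pow (n := n + 2) hd hCm hC1 x β
  have hiB : Integrable (fun k => (((-4) * B k * Chat d 1 k) * Real.cos (β * DhatSym d x k))
      * Chat d 1 k ^ n) (P d) := by
    refine (hiB'.const_mul (-4)).congr (ae_of_all _ fun k => ?_)
    simp only [pow_succ]
    ring
  have hiC : Integrable (fun k => ((4 * C k * Chat d 1 k ^ 2) * Real.cos (β * DhatSym d x k))
      * Chat d 1 k ^ n) (P d) := by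
    refine (hiC'.const_mul 4).congr (ae_of_all _ fun k => ?_)
    simp only [pow_add]
    ring
  have hiBC : Integrable (fun k => (((-4) * B k * Chat d 1 k + 4 * C k * Chat d 1 k ^ 2)
      * Real.cos (β * DhatSym d x k)) * Chat d 1 k ^ n) (P d) := by
    refine (hiB.add hiC).congr (ae_of_all _ fun k => ?_)
    simp only [Pi.add_apply]
    ring
  have hw' : (fun k => w k * Mhat d k ^ 2)
      = fun k => A k + ((-4) * B k * Chat d 1 k + 4 * C k * Chat d 1 k ^ 2) := by
    funext k
    simp only [hA, hB, hC, Mhat]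
    ring
  have eB : srwTwist d n (fun k => (-4) * B k * Chat d 1 k) x β = -4 * srwTwist d (n + 1) B x β := by
    have h : (fun k => (-4) * B k * Chat d 1 k) = fun k => (-4) * (B k * Chat d 1 k ^ 1) := by
      funext k; rw [pow_one]; ring
    rw [h, srwTwist_const_mul_weight, srwTwist_weight_mul_Chat_pow_eq]
  have eC : srwTwist d n (fun k => 4 * C k * Chat d 1 k ^ 2) x β = 4 * srwTwist d (n + 2) C x β := by
    have h : (fun k => 4 * C k * Chat d 1 k ^ 2) = fun k => 4 * (C k * Chat d 1 k ^ 2) := by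
      funext k; ring
    rw [h, srwTwist_const_mul_weight, srwTwist_weight_mul_Chat_pow_eq]
  rw [hw', srwTwist_add_weight A (fun k => (-4) * B k * Chat d 1 k + 4 * C k * Chat d 1 k ^ 2) x β
    hiA hiBC, srwTwist_add_weight (fun k => (-4) * B k * Chat d 1 k) (fun k => 4 * C k * Chat d 1 k ^ 2)
    x β hiB hiC, eB, eC]
  ring

/-! ### Truncating the rows of a product cos-power seed costs plain seeds -/

/-- `(x+ρ)^d − x^d = Σ_{k<d} C(d,k+1) x^{d−k−1} ρ^{k+1}`. [folklore] -/
private theorem add_pow_sub_pow_eq_sum' (x ρ : ℝ) (d : ℕ) :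
    (x + ρ) ^ d - x ^ d
      = ∑ k ∈ Finset.range d, (d.choose (k + 1) : ℝ) * x ^ (d - (k + 1)) * ρ ^ (k + 1) := by
  rw [add_comm, add_pow, Finset.sum_range_succ']
  simp only [pow_zero, Nat.sub_zero, Nat.choose_zero_right, Nat.cast_one, mul_one, one_mul,
    add_sub_cancel_right]
  exact Finset.sum_congr rfl fun k _ => by ring

/-- Monotonicity of the product increment: `Π(x_i+ρ) − Π x_i ≤ Π(α+ρ) − Π α` for `0 ≤ x_i ≤ α`,
`0 ≤ ρ`. [folklore] -/
private theorem prod_add_const_sub_prod_le_of_le {ι : Type*} (s : Finset ι) (x : ι → ℝ) {α ρ : ℝ}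
    (hx0 : ∀ i ∈ s, 0 ≤ x i) (hxα : ∀ i ∈ s, x i ≤ α) (hρ : 0 ≤ ρ) :
    ∏ i ∈ s, (x i + ρ) - ∏ i ∈ s, x i ≤ ∏ _i ∈ s, (α + ρ) - ∏ _i ∈ s, α := by
  classical
  induction s using Finset.induction_on with
  | empty => simp
  | insert j s hj ih =>
    have hx0' : ∀ i ∈ s, 0 ≤ x i := fun i hi => hx0 i (Finset.mem_insert_of_mem hi)
    have hxα' : ∀ i ∈ s, x i ≤ α := fun i hi => hxα i (Finset.mem_insert_of_mem hi)
    have ih' := ih hx0' hxα'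
    have hxj0 : 0 ≤ x j := hx0 j (Finset.mem_insert_self j s)
    have hxjα : x j ≤ α := hxα j (Finset.mem_insert_self j s)
    rw [Finset.prod_insert hj, Finset.prod_insert hj, Finset.prod_insert hj, Finset.prod_insert hj]
    set Pp := ∏ i ∈ s, (x i + ρ) with hPp
    set P0 := ∏ i ∈ s, x i with hP0
    set Ap := ∏ _i ∈ s, (α + ρ) with hAp
    set A0 := ∏ _i ∈ s, α with hA0
    have hP0P : P0 ≤ Pp := Finset.prod_le_prod hx0' (fun i hi => by linarith)
    have hPpA : Pp ≤ Ap :=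
      Finset.prod_le_prod (fun i hi => by linarith [hx0' i hi]) (fun i hi => by linarith [hxα' i hi])
    have hD0 : 0 ≤ Ap - A0 := (sub_nonneg.2 hP0P).trans ih'
    have e1 : x j * (Pp - P0) ≤ α * (Ap - A0) :=
      (mul_le_mul_of_nonneg_left ih' hxj0).trans (mul_le_mul_of_nonneg_right hxjα hD0)
    have e2 : ρ * Pp ≤ ρ * Ap := mul_le_mul_of_nonneg_left hPpA hρ
    calc (x j + ρ) * Pp - x j * P0 = x j * (Pp - P0) + ρ * Pp := by ring
      _ ≤ α * (Ap - A0) + ρ * Ap := add_le_add e1 e2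
      _ = (α + ρ) * Ap - α * A0 := by ring

/-- **Row truncation of a PRODUCT cos-power twisted seed costs plain seeds** (the product analogue of
`abs_srwTwist_sub_rowTrunc_le_sum_srwI_unit`). For `d ≥ 2n+3`, `m ≠ 0`, cos-powers `a_μ ≤ a_max`,
a truncation order `J` and `M ≤ |m|` with `a_max ≤ (J+1)M`:
`|Tw^{Π_μ cos^{a_μ}}_{n+1}(m e_i; β) − (n!)⁻¹(∫₀^∞ τⁿe^{-τ} Re Π_μ P^{(a_μ)}_J(τ/d, β/d) dτ)/(2π)^d|`
`≤ Σ_{k<d} C(d,k+1) (2δ_J(β/d))^{k+1} · srwI d (n+1) 0 (((J+1)M − a_max)(e_0+…+e_k))`,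
where `P^{(a)}_J(v,y) = Σ_{j≤J} ε_j W^{(a)}_j(v)·2π iʲ J_j(y)` is the folded truncated `cos^a` row and
`δ_J(y) = Σ_{l≥0}|J_{l+J+1}(y)|`: each factor is anchored at `‖T^{(a_μ)}‖ ≤ 2π I_0` with the one-weight
ball `4π I_{(J+1)|m|−a_μ} δ_J ≤ 4π I_{(J+1)M−a_max} δ_J`, the product perturbation inequality and
`(x+ρ)^d − x^d` monotone give `(2π)^d((I_0 + 2δ_J I_c)^d − I_0^d)` pointwise in `τ`, and
`e^{-τ} I_c(τ/d)^k I_0(τ/d)^{d−k} = Π_μ q_{τ/d}(x_μ)` integrates to plain seeds.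
[cite: FitznerVanDerHofstad2016NoBLE, (3.34)–(3.36) p. 1071, §5.1.1 (5.2)–(5.5); DLMF, 10.35.2, 10.14.4] -/
theorem abs_srwTwist_prodCosPow_sub_rowTrunc_le_sum_srwI (n : ℕ) (hd : 2 * (n + 1) + 1 ≤ d)
    (i : Fin d) {m : ℤ} (hm : m ≠ 0) (β : ℝ) (a : Fin d → ℕ) (J M amax : ℕ) (hM : M ≤ m.natAbs)
    (ha : ∀ μ, a μ ≤ amax) (hamax : amax ≤ (J + 1) * M) :
    |srwTwist d (n + 1) (fun k => ∏ μ, Real.cos (k μ) ^ a μ) (Pi.single i m) β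
      - (n ! : ℝ)⁻¹ * (∫ τ in Ioi (0:ℝ), τ ^ n * (Real.exp (-τ) *
          (∏ μ, ∑ j ∈ Finset.range (J + 1), (if j = 0 then (1 : ℂ) else 2)
            * ((∑ s ∈ Finset.range (a μ + 1), (((a μ).choose s : ℂ) / 2 ^ (a μ))
                * (besselI (j * m - ((2 * (s : ℤ) - (a μ : ℕ) : ℤ))) (τ / d) : ℂ))
              * (2 * π * Complex.I ^ j * (besselJ j (β / d) : ℂ)))).re)) / (2 * π) ^ d|
    ≤ ∑ k ∈ Finset.range d, (d.choose (k + 1) : ℝ)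
        * (2 * ∑' l : ℕ, |besselJ (l + J + 1) (β / d)|) ^ (k + 1)
        * srwI d (n + 1) 0
            (fun μ : Fin d => if (μ : ℕ) < k + 1 then ((((J + 1) * M - amax : ℕ)) : ℤ) else 0) := by
  have hd1 : 1 ≤ d := by omega
  have hd3 : 2 * n + 3 ≤ d := by omega
  have hd0 : (0 : ℝ) < d := by exact_mod_cast (by omega : 0 < d)
  have hπ : (0 : ℝ) < π := Real.pi_pos
  have hn0 : (n ! : ℝ) ≠ 0 := by positivity
  -- abbreviations
  set y : ℝ := β / d with hy
  set δ : ℝ := ∑' l : ℕ, |besselJ (l + J + 1) y| with hδ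
  set c : ℤ := ((((J + 1) * M - amax : ℕ)) : ℤ) with hc
  have hδ0 : 0 ≤ δ := tsum_nonneg fun l => abs_nonneg _
  have hJM : (J + 1) * M ≤ (J + 1) * m.natAbs := Nat.mul_le_mul_left _ hM
  have haJ : ∀ μ, a μ ≤ (J + 1) * m.natAbs := fun μ => (ha μ).trans (hamax.trans hJM)
  -- the functions of `τ`
  set Tf : Fin d → ℝ → ℂ := fun μ τ => ∫ t, (((Real.cos t) ^ a μ : ℝ) : ℂ)
      * Complex.exp (((τ / d * Real.cos t : ℝ) : ℂ) + ((β / d * Real.cos (m * t) : ℝ) : ℂ) * Complex.I) ∂μI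
    with hTf
  set Pf : Fin d → ℝ → ℂ := fun μ τ => ∑ j ∈ Finset.range (J + 1), (if j = 0 then (1 : ℂ) else 2)
      * ((∑ s ∈ Finset.range (a μ + 1), (((a μ).choose s : ℂ) / 2 ^ (a μ))
          * (besselI (j * m - ((2 * (s : ℤ) - (a μ : ℕ) : ℤ))) (τ / d) : ℂ))
        * (2 * π * Complex.I ^ j * (besselJ j (β / d) : ℂ))) with hPf
  set f : ℝ → ℝ := fun τ => τ ^ n * (Real.exp (-τ) * (∏ μ, Tf μ τ).re) with hf
  set g : ℝ → ℝ := fun τ => τ ^ n * (Real.exp (-τ) * (∏ μ, Pf μ τ).re) with hg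
  set pt : ℕ → Fin d → ℤ := fun k μ => if (μ : ℕ) < k + 1 then c else 0 with hpt
  set coef : ℕ → ℝ := fun k => (d.choose (k + 1) : ℝ) * (2 * δ) ^ (k + 1) with hcoef
  have hcoef0 : ∀ k, 0 ≤ coef k := fun k => by simp only [hcoef]; positivity
  set h : ℝ → ℝ := fun τ => ∑ k ∈ Finset.range d, ((2 * π) ^ d * coef k)
      * (τ ^ n * ∏ μ : Fin d, srwHeatKernel (τ / d) (pt k μ)) with hh
  -- Step 1: the u-representation of the product-weighted twisted seed
  have hgc : ∀ μ, Continuous (fun t : ℝ => Real.cos t ^ a μ) := fun μ => Real.continuous_cos.pow _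
  have hg1 : ∀ μ (t : ℝ), |Real.cos t ^ a μ| ≤ 1 := fun μ t => by
    rw [abs_pow]; exact pow_le_one₀ (abs_nonneg _) (Real.abs_cos_le_one t)
  have hrepr : srwTwist d (n + 1) (fun k => ∏ μ, Real.cos (k μ) ^ a μ) (Pi.single i m) β
      = (n ! : ℝ)⁻¹ * (∫ τ in Ioi (0:ℝ), f τ) / (2 * π) ^ d := by
    exact srwTwist_succ_prod_single_eq_integral n hd i m β (fun μ t => Real.cos t ^ a μ) hgc hg1
  -- Step 2: pointwise bounds for `τ > 0`
  have hT_le : ∀ μ (τ : ℝ), 0 < τ → ‖Tf μ τ‖ ≤ 2 * π * besselI 0 (τ / d) := fun μ τ hτ =>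
    norm_cosPowRow_μI_le (a μ) (τ / d) (β / d) m
  have hTP_le : ∀ μ (τ : ℝ), 0 < τ → ‖Tf μ τ - Pf μ τ‖ ≤ 4 * π * besselI c (τ / d) * δ := by
    intro μ τ hτ
    have hv : 0 ≤ τ / d := by positivity
    have h1 := norm_cosPowRow_sub_foldTrunc_le hv y hm (a μ) J (haJ μ)
    have h2 : besselI ((((J + 1) * m.natAbs - a μ : ℕ)) : ℤ) (τ / d) ≤ besselI c (τ / d) := by
      refine besselI_le_of_natAbs_le hv ?_
      simp only [hc, Int.natAbs_natCast]
      have h3 := ha μ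
      generalize (J + 1) * M = X at hamax hJM ⊢
      generalize (J + 1) * m.natAbs = Y at hJM ⊢
      omega
    calc ‖Tf μ τ - Pf μ τ‖
        ≤ 4 * π * besselI ((((J + 1) * m.natAbs - a μ : ℕ)) : ℤ) (τ / d) * δ := h1
      _ ≤ 4 * π * besselI c (τ / d) * δ := by gcongr
  have hP_le : ∀ μ (τ : ℝ), 0 < τ → ‖Pf μ τ‖ ≤ 2 * π * (1 + 2 * δ) * besselI 0 (τ / d) := by
    intro μ τ hτ
    have hv : 0 ≤ τ / d := by positivity
    have hc0 : besselI c (τ / d) ≤ besselI 0 (τ / d) := besselI_le_of_natAbs_le hv (by simp)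
    have hI0 : 0 ≤ besselI 0 (τ / d) := besselI_nonneg hv 0
    calc ‖Pf μ τ‖ = ‖Tf μ τ - (Tf μ τ - Pf μ τ)‖ := by rw [sub_sub_cancel]
      _ ≤ ‖Tf μ τ‖ + ‖Tf μ τ - Pf μ τ‖ := norm_sub_le _ _
      _ ≤ 2 * π * besselI 0 (τ / d) + 4 * π * besselI c (τ / d) * δ :=
          add_le_add (hT_le μ τ hτ) (hTP_le μ τ hτ)
      _ ≤ 2 * π * besselI 0 (τ / d) + 4 * π * besselI 0 (τ / d) * δ := by gcongr
      _ = 2 * π * (1 + 2 * δ) * besselI 0 (τ / d) := by ring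
  -- |f - g| ≤ h pointwise on `(0,∞)`
  have hfg_le : ∀ τ : ℝ, 0 < τ → ‖f τ - g τ‖ ≤ h τ := by
    intro τ hτ
    have hv : 0 ≤ τ / d := by positivity
    have hI0 : 0 ≤ besselI 0 (τ / d) := besselI_nonneg hv 0
    have hIc : 0 ≤ besselI c (τ / d) := besselI_nonneg hv c
    set α : ℝ := 2 * π * besselI 0 (τ / d) with hα
    set ρ : ℝ := 4 * π * besselI c (τ / d) * δ with hρ
    have hα0 : 0 ≤ α := by positivity
    have hρ0 : 0 ≤ ρ := by positivity
    -- |Re Π T − Re Π P| ≤ Π(‖T_μ‖+ρ) − Π‖T_μ‖ ≤ (α+ρ)^d − α^d  (anchored at T)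
    have hre : |(∏ μ, Tf μ τ).re - (∏ μ, Pf μ τ).re| ≤ (α + ρ) ^ d - α ^ d := by
      have hPT : ∀ μ ∈ (Finset.univ : Finset (Fin d)), ‖Pf μ τ - Tf μ τ‖ ≤ ρ := fun μ _ => by
        rw [norm_sub_rev]; exact hTP_le μ τ hτ
      have h1 := abs_re_prod_add_sub_re_prod_le Finset.univ (fun μ => Tf μ τ)
        (fun μ => Pf μ τ - Tf μ τ) (fun _ => ρ) hPT
      simp only [add_sub_cancel] at h1
      rw [abs_sub_comm] at h1
      refine h1.trans ?_
      have h2 := prod_add_const_sub_prod_le_of_le Finset.univ (fun μ => ‖Tf μ τ‖) (fun μ _ => norm_nonneg _)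
        (fun μ _ => hT_le μ τ hτ) hρ0
      rw [Finset.prod_const, Finset.prod_const, Finset.card_univ, Fintype.card_fin] at h2
      exact h2
    have e1 : f τ - g τ = τ ^ n * Real.exp (-τ) * ((∏ μ, Tf μ τ).re - (∏ μ, Pf μ τ).re) := by
      simp only [hf, hg]; ring
    rw [e1, Real.norm_eq_abs, abs_mul, abs_of_nonneg (by positivity : (0:ℝ) ≤ τ ^ n * Real.exp (-τ))]
    calc τ ^ n * Real.exp (-τ) * |(∏ μ, Tf μ τ).re - (∏ μ, Pf μ τ).re|
        ≤ τ ^ n * Real.exp (-τ) * ((α + ρ) ^ d - α ^ d) := by gcongr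
      _ = τ ^ n * Real.exp (-τ) * ∑ k ∈ Finset.range d,
            (d.choose (k + 1) : ℝ) * α ^ (d - (k + 1)) * ρ ^ (k + 1) := by
          rw [add_pow_sub_pow_eq_sum']
      _ = h τ := by
          simp only [hh, hcoef, Finset.mul_sum]
          refine Finset.sum_congr rfl fun k hk => ?_
          have hk' : k + 1 ≤ d := Finset.mem_range.1 hk
          rw [← exp_neg_mul_besselI_pow_mul_pow_eq_prod_srwHeatKernel hd1 hk' c τ]
          simp only [hα, hρ]
          rw [mul_pow, mul_pow, mul_pow, mul_pow]
          have e2 : (2 * π : ℝ) ^ d = (2 * π) ^ (d - (k + 1)) * (2 * π) ^ (k + 1) := by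
            rw [← pow_add, Nat.sub_add_cancel hk']
          have e3 : (4 * π : ℝ) ^ (k + 1) = (2 * π) ^ (k + 1) * 2 ^ (k + 1) := by
            rw [← mul_pow]; ring
          rw [e2, e3]
          ring
  -- Step 3: integrability
  have hcontI : ∀ b : ℤ, Continuous fun τ : ℝ => besselI b (τ / d) := by
    intro b
    have e : (fun τ : ℝ => besselI b (τ / d))
        = fun τ => Real.exp (τ / d) * srwHeatKernel (τ / d) b := by
      ext τ
      rw [srwHeatKernel_eq_exp_neg_mul_besselI, ← mul_assoc, ← Real.exp_add, add_neg_cancel,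
        Real.exp_zero, one_mul]
    rw [e]
    exact ((Real.continuous_exp.comp (continuous_id.div_const _))).mul
      ((continuous_srwHeatKernel_left b).comp (continuous_id.div_const _))
  have hPcont : ∀ μ, Continuous (Pf μ) := by
    intro μ
    simp only [hPf]
    refine continuous_finsetSum _ fun j _ => continuous_const.mul ((?_ : Continuous _).mul continuous_const)
    refine continuous_finsetSum _ fun s _ => continuous_const.mul ?_
    exact Complex.continuous_ofReal.comp (hcontI _)
  have hgcont : Continuous g := by
    simp only [hg]
    exact (continuous_pow n).mul ((Real.continuous_exp.comp continuous_neg).mul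
      (Complex.continuous_re.comp (continuous_finsetProd _ fun μ _ => hPcont μ)))
  have hTsm : ∀ μ, StronglyMeasurable (Tf μ) := by
    intro μ
    have hF : Continuous (Function.uncurry fun (τ t : ℝ) => (((Real.cos t) ^ a μ : ℝ) : ℂ)
        * Complex.exp (((τ / d * Real.cos t : ℝ) : ℂ) + ((β / d * Real.cos (m * t) : ℝ) : ℂ) * Complex.I)) := by
      show Continuous fun p : ℝ × ℝ => (((Real.cos p.2) ^ a μ : ℝ) : ℂ)
        * Complex.exp (((p.1 / d * Real.cos p.2 : ℝ) : ℂ) + ((β / d * Real.cos (m * p.2) : ℝ) : ℂ) * Complex.I)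
      fun_prop
    exact hF.stronglyMeasurable.integral_prod_right (ν := μI)
  have hprodm : Measurable fun τ => ∏ μ, Tf μ τ :=
    Finset.measurable_prod _ fun μ _ => (hTsm μ).measurable
  have hfsm : AEStronglyMeasurable f (volume.restrict (Ioi 0)) := by
    have h1 : Measurable f := by
      simp only [hf]
      exact (measurable_id.pow_const n).mul
        ((Real.measurable_exp.comp measurable_neg).mul (Complex.measurable_re.comp hprodm))
    exact h1.aestronglyMeasurable
  have hI0int := integrableOn_pow_mul_srwHeatKernel_zero_pow n hd3
  -- |g| ≤ (2π(1+2δ))^d τ^n q_{τ/d}(0)^d, |f| ≤ (2π)^d τ^n q_{τ/d}(0)^d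
  have hdom : ∀ (C : ℝ) (F : Fin d → ℝ → ℂ), 0 ≤ C →
      (∀ μ (τ : ℝ), 0 < τ → ‖F μ τ‖ ≤ C * besselI 0 (τ / d)) →
      ∀ τ : ℝ, 0 < τ → ‖τ ^ n * (Real.exp (-τ) * (∏ μ, F μ τ).re)‖
        ≤ C ^ d * (τ ^ n * srwHeatKernel (τ / d) 0 ^ d) := by
    intro C F hC hF τ hτ
    have hv : 0 ≤ τ / d := by positivity
    have hq : Real.exp (-τ) * besselI 0 (τ / d) ^ d = srwHeatKernel (τ / d) 0 ^ d := by
      have := exp_neg_mul_besselI_pow_mul_pow_eq_prod_srwHeatKernel hd1 (le_refl d) 0 τ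
      rw [Nat.sub_self, pow_zero, mul_one] at this
      rw [this]
      have e : ∀ μ : Fin d, (if (μ : ℕ) < d then (0:ℤ) else 0) = 0 := fun μ => by split_ifs <;> rfl
      simp_rw [e]
      rw [Fin.prod_const]
    have hre : |(∏ μ, F μ τ).re| ≤ (C * besselI 0 (τ / d)) ^ d := by
      calc |(∏ μ, F μ τ).re| ≤ ‖∏ μ, F μ τ‖ := Complex.abs_re_le_norm _
        _ = ∏ μ, ‖F μ τ‖ := norm_prod _ _
        _ ≤ ∏ _μ : Fin d, (C * besselI 0 (τ / d)) :=
            Finset.prod_le_prod (fun μ _ => norm_nonneg _) (fun μ _ => hF μ τ hτ)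
        _ = (C * besselI 0 (τ / d)) ^ d := by
            rw [Finset.prod_const, Finset.card_univ, Fintype.card_fin]
    rw [norm_mul, norm_mul, Real.norm_eq_abs, Real.norm_eq_abs, Real.norm_eq_abs,
      abs_of_nonneg (pow_nonneg hτ.le n), abs_of_pos (Real.exp_pos _)]
    calc τ ^ n * (Real.exp (-τ) * |(∏ μ, F μ τ).re|)
        ≤ τ ^ n * (Real.exp (-τ) * (C * besselI 0 (τ / d)) ^ d) := by gcongr
      _ = C ^ d * (τ ^ n * (Real.exp (-τ) * besselI 0 (τ / d) ^ d)) := by rw [mul_pow]; ring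
      _ = C ^ d * (τ ^ n * srwHeatKernel (τ / d) 0 ^ d) := by rw [hq]
  have hgint : Integrable g (volume.restrict (Ioi 0)) := by
    refine Integrable.mono' ((hI0int.const_mul ((2 * π * (1 + 2 * δ)) ^ d)))
      hgcont.aestronglyMeasurable ?_
    rw [ae_restrict_iff' measurableSet_Ioi]
    exact Eventually.of_forall fun τ hτ => hdom (2 * π * (1 + 2 * δ)) Pf (by positivity) hP_le τ hτ
  have hfint : Integrable f (volume.restrict (Ioi 0)) := by
    refine Integrable.mono' ((hI0int.const_mul ((2 * π) ^ d))) hfsm ?_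
    rw [ae_restrict_iff' measurableSet_Ioi]
    exact Eventually.of_forall fun τ hτ => hdom (2 * π) Tf (by positivity) hT_le τ hτ
  have hhint : Integrable h (volume.restrict (Ioi 0)) := by
    simp only [hh]
    refine integrable_finsetSum _ fun k hk => ?_
    exact ((integrableOn_pow_mul_prod_srwHeatKernel n hd3 (pt k)).const_mul _)
  -- Step 4: the integral of the majorant is the sum of seeds
  have hh_int : ∫ τ in Ioi (0:ℝ), h τ
      = ∑ k ∈ Finset.range d, ((2 * π) ^ d * coef k) * ((n ! : ℝ) * srwI d (n + 1) 0 (pt k)) := by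
    simp only [hh]
    rw [integral_finsetSum _ (fun k _ =>
      ((integrableOn_pow_mul_prod_srwHeatKernel n hd3 (pt k)).const_mul _))]
    refine Finset.sum_congr rfl fun k _ => ?_
    rw [integral_const_mul]
    congr 1
    rw [srwI_succ_zero_eq_integral_prod_srwHeatKernel_div n hd3 (pt k)]
    field_simp
  -- Step 5: assemble
  have hdiff : srwTwist d (n + 1) (fun k => ∏ μ, Real.cos (k μ) ^ a μ) (Pi.single i m) β
      - (n ! : ℝ)⁻¹ * (∫ τ in Ioi (0:ℝ), g τ) / (2 * π) ^ d
      = (n ! : ℝ)⁻¹ * (∫ τ in Ioi (0:ℝ), (f τ - g τ)) / (2 * π) ^ d := by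
    rw [hrepr, integral_sub hfint hgint]
    ring
  have hnorm : ‖∫ τ in Ioi (0:ℝ), (f τ - g τ)‖ ≤ ∫ τ in Ioi (0:ℝ), h τ := by
    refine norm_integral_le_of_norm_le hhint ?_
    rw [ae_restrict_iff' measurableSet_Ioi]
    exact Eventually.of_forall fun τ hτ => hfg_le τ hτ
  show |srwTwist d (n + 1) (fun k => ∏ μ, Real.cos (k μ) ^ a μ) (Pi.single i m) β
      - (n ! : ℝ)⁻¹ * (∫ τ in Ioi (0:ℝ), g τ) / (2 * π) ^ d|
    ≤ ∑ k ∈ Finset.range d, coef k * srwI d (n + 1) 0 (pt k)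
  rw [hdiff, abs_div, abs_mul, abs_of_pos (by positivity : (0:ℝ) < (n ! : ℝ)⁻¹),
    abs_of_pos (by positivity : (0:ℝ) < (2 * π) ^ d), ← Real.norm_eq_abs]
  calc (n ! : ℝ)⁻¹ * ‖∫ τ in Ioi (0:ℝ), (f τ - g τ)‖ / (2 * π) ^ d
      ≤ (n ! : ℝ)⁻¹ * (∫ τ in Ioi (0:ℝ), h τ) / (2 * π) ^ d := by gcongr
    _ = ∑ k ∈ Finset.range d, coef k * srwI d (n + 1) 0 (pt k) := by
        rw [hh_int, Finset.mul_sum, Finset.sum_div]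
        refine Finset.sum_congr rfl fun k _ => ?_
        field_simp

/-- **One-seed coarsening** of `abs_srwTwist_prodCosPow_sub_rowTrunc_le_sum_srwI` (the product analogue
of `abs_srwTwist_sub_rowTrunc_le_incr_mul_srwI_unit`): since two-level seeds are dominated by the axis seed
(`srwI_twoLevel_le_axis`) and `Σ_{k<d} C(d,k+1)(2δ)^{k+1} = (1+2δ)^d − 1`,
`|Tw^{Π cos^{a_μ}}_{n+1}(m e_i;β) − (truncation)| ≤ ((1+2δ_J)^d − 1)·srwI d (n+1) 0 (((J+1)M − a_max) e_0)`.
[cite: FitznerVanDerHofstad2016NoBLE, (3.34)–(3.36) p. 1071, §5.1.1 (5.2)–(5.5); DLMF, 10.37, 10.14.4] -/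
theorem abs_srwTwist_prodCosPow_sub_rowTrunc_le_incr_mul_srwI (n : ℕ) (hd : 2 * (n + 1) + 1 ≤ d)
    (i : Fin d) {m : ℤ} (hm : m ≠ 0) (β : ℝ) (a : Fin d → ℕ) (J M amax : ℕ) (hM : M ≤ m.natAbs)
    (ha : ∀ μ, a μ ≤ amax) (hamax : amax ≤ (J + 1) * M) :
    |srwTwist d (n + 1) (fun k => ∏ μ, Real.cos (k μ) ^ a μ) (Pi.single i m) β
      - (n ! : ℝ)⁻¹ * (∫ τ in Ioi (0:ℝ), τ ^ n * (Real.exp (-τ) *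
          (∏ μ, ∑ j ∈ Finset.range (J + 1), (if j = 0 then (1 : ℂ) else 2)
            * ((∑ s ∈ Finset.range (a μ + 1), (((a μ).choose s : ℂ) / 2 ^ (a μ))
                * (besselI (j * m - ((2 * (s : ℤ) - (a μ : ℕ) : ℤ))) (τ / d) : ℂ))
              * (2 * π * Complex.I ^ j * (besselJ j (β / d) : ℂ)))).re)) / (2 * π) ^ d|
    ≤ ((1 + 2 * ∑' l : ℕ, |besselJ (l + J + 1) (β / d)|) ^ d - 1)
        * srwI d (n + 1) 0
            (fun μ : Fin d => if (μ : ℕ) < 1 then ((((J + 1) * M - amax : ℕ)) : ℤ) else 0) := by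
  have hd3 : 2 * n + 3 ≤ d := by omega
  set δ : ℝ := ∑' l : ℕ, |besselJ (l + J + 1) (β / d)| with hδ
  set c : ℤ := ((((J + 1) * M - amax : ℕ)) : ℤ) with hc
  have hδ0 : 0 ≤ δ := tsum_nonneg fun l => abs_nonneg _
  have h := abs_srwTwist_prodCosPow_sub_rowTrunc_le_sum_srwI n hd i hm β a J M amax hM ha hamax
  refine h.trans ?_
  have e : (1 + 2 * δ) ^ d - 1 = (1 + 2 * δ) ^ d - 1 ^ d := by rw [one_pow]
  rw [e, add_pow_sub_pow_eq_sum' 1 (2 * δ) d, Finset.sum_mul]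
  refine Finset.sum_le_sum fun k hk => ?_
  rw [one_pow, mul_one]
  have hmono := srwI_twoLevel_le_axis (d := d) n hd3 (k := k + 1) (by omega) c
  have hcoef : 0 ≤ (d.choose (k + 1) : ℝ) * (2 * δ) ^ (k + 1) := by positivity
  exact mul_le_mul_of_nonneg_left hmono hcoef

end Literature.Probability.FitznerVanDerHofstad2017
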